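import Literature.NumberTheory.EllipticCurves.EisensteinNewformLevelRaisingInertiaLocalGlobalTwistProofs
import Literature.NumberTheory.EllipticCurves.EisensteinNewformLevelRaisingInertiaZetaPoleProofs
import Literature.NumberTheory.Automorphic.WeilDeligneEulerFactorInvarianceProofs
import Literature.NumberTheory.GaloisRepresentations.WeilDeligneRepFrobSemisimpleProofs
import Literature.NumberTheory.EllipticCurves.NewformGaloisRepInertiaInvariants
import Literature.NumberTheory.EllipticCurves.HasseWeilAbelianCoinvariantsProofs
import Literature.NumberTheory.EllipticCurves.HasseWeilAbelianUnramifiedProofs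
import Literature.NumberTheory.EllipticCurves.AnalyticRankOverNumberFieldArtinProofs
import HarnessLib

/-!
# Carayol's theorem (A) in Euler-factor form for `ρ_{g,p}` at every `ℓ ≠ p`, from the local–global
# carrier; `L(E/F, s)` entire for abelian `F` modulo four existing named facts

Topic `Literature/NumberTheory/EllipticCurves`; proof file (THEOREMS ONLY: no definition, no named
fact, no instance; D-0026), sibling of `AnalyticRankOverNumberField` (the named fact
`hasEntireLFunction_baseChange_fixedField`, BCDT 2001 Thm. A + Artin formalism) and of
`AnalyticRankOverNumberFieldArtinProofs` (its reduction
`hasEntireLFunction_baseChange_fixedField_of_modularity_of_carayol hX hD hC`, whose third hypothesis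
`hC` — Carayol's theorem in Euler-factor form — was an INLINE hypothesis carried by no named fact).

## Main results

* `carayol_eulerFactor_of_localGlobal (hLG) (hCd)` : the hypothesis `hC` verbatim — for every newform
  `g ∈ S_k(Γ₁(N))`, `k ≥ 2`, `ι : ℚ̄_p ≃ ℂ`, `ρ : Γ_ℚ → GL₂(ℚ̄_p)` irreducible and attached to `g` away
  from `Np`, every prime `ℓ ≠ p`, `𝔔 ∣ ℓ` and arithmetic Frobenius `σ ∈ D_𝔔`,
  `det(1 - σ T | ρ_{I_𝔔}) = 1 - ι⁻¹(a_ℓ) T + ι⁻¹(ε(ℓ) ℓ^{k-1}) T²` — from the tree's named facts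
  `Automorphic.galoisRep_GL2_totallyReal_localGlobal` (`hLG`: local–global compatibility at every
  finite place, Carayol 1986 Thm. (A) / Skinner 2009, with Harris–Taylor's `rec_v`) and
  `Carayol1986_finrank_inertiaInvariants` (`hCd`: `dim V^{I_ℓ} = deg(1 - a_ℓ T)`).
* `hasEntireLFunction_baseChange_fixedField_of_modularity_of_localGlobal (hX) (hD) (hLG) (hCd) :
  hasEntireLFunction_baseChange_fixedField` — the named fact CLOSED MODULO the four existing named
  facts `exists_isNewformOf` (modularity), `Hida2000_thm326_exists_galoisRep` (Deligne),
  `galoisRep_GL2_totallyReal_localGlobal`, `Carayol1986_finrank_inertiaInvariants`.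

## The argument (Carayol 1986, Thm. (A), read on the `ℓ`-Euler factor; Rohrlich 1997, §3.8 Thm. 5)

* `ℓ ∤ N` (`reverse_charpoly_toInertiaCoinvariants_of_not_dvd`): unramified, the Frobenius polynomial
  is the Hecke polynomial (`IsGaloisRepOfNewform1`, `ContinuousRep.charpoly_toInertiaCoinvariants`).
* `ℓ ∣ N` (Parts 4–6).  As in `Hida2000Thm326.inertia_of_level_of_localGlobal'` apply the carrier to
  `π = π_g ⊗ |det|^{(k-1)/2}` (`exists_detTwist_datum`) and `r = ρ ⊗ θ₀⁻¹`, `θ₀ = ι⁻¹ ∘ ε ∘ χ_N`: at the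
  place `w` of `ℓ` it returns the local component `π_w`, the Weil–Deligne representation `r_w` of
  `r|_{W_{ℚ_w}}` (Grothendieck–Deligne recipe), its transport `ι(r_w)` and `ι(r_w)^{F-ss} ∈ rec(π_w)`.
  The package `exists_twist_weilDeligne_dvd` adds `(1 - a_ℓ ℓ^{1-k} X) ∣ det(1 - TΦ | (ker N)^I)` for
  `ι(r_w)`: its Euler factor is that of `ι(r_w)^{F-ss}` (`eulerFactor_eq_of_isFrobSemisimplificationOf`),
  i.e. the JPSS `L`-polynomial `P₀` of the pair `(π_w, 𝟙)` (clause (iii-L) of the local Langlands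
  datum, `eulerFactor_tprod_out_eq_of_hasClass`), which the pole of the `K₁(N)`-new vector divides
  (`one_sub_C_mul_X_dvd_of_hasRSLFactor_of_localComponent`; `U_w`-eigenvalue
  `ℓ^{-(k-1)/2} a_ℓ/(√ℓ)^{k-2}`, so the pole is at `a_ℓ ℓ^{1-k}`, `detTwist_eigenvalue_div_mul_sqrt`).
  - `a_ℓ ≠ 0` (Part 5): `dim (ker N)^I ≤ 1` (else `r` is unramified at the prime `𝔓₀` of the
    completion and `ρ = θ₀ r` is scalar on `I_{𝔓₀}`, contradicting Carayol's `dim V^{I} = 1`), so the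
    divisibility gives an eigenline (`exists_mem_inertiaInvariantsKerN_apply_eq_smul`), hence
    `x ∈ ℚ̄_p²` fixed by `r(I_{𝔓₀})` with `r(Frob) x = ι⁻¹(a_ℓ ℓ^{1-k})⁻¹ x` for the ARITHMETIC
    Frobenii at `𝔓₀` (`I_{𝔓₀} = res I_{ℚ_w}`, Frobenius at `𝔓₀` = `res` of a degree-one Weil element);
    moved to `𝔔` by conjugation.  Since `det ρ = θ₀ χ_p^{k-1}` (`det_eq_of_isGaloisRepOfNewform1`),
    inertia moves every vector along `x` and acts non-trivially, the coinvariants are the line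
    `V / ℚ̄_p x` and `σ` acts on it by `det ρ(σ) / (θ₀(σ) ι⁻¹(a_ℓ ℓ^{1-k})⁻¹) = ι⁻¹(a_ℓ)`
    (`charpoly_toCoinvariants_of_line`, `FramedRep.charpoly_toInertiaCoinvariants_of_eigenvector`);
    `ε(ℓ) = 0`.
  - `a_ℓ = 0` (Part 6): Carayol gives `V^{I} = 0`; on `I_{𝔓₀}`, `ρ(u) = θ₀(u) r_w.ρ(u) exp(t(u)N)`
    with `r_w.ρ(I)` finite: if `N = 0` the image of inertia is finite and averaging kills the
    coinvariants (`Coinvariants.ker_eq_top_of_finite`); if `N ≠ 0` every `ρ(u)` commutes with `N`,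
    some `ρ(u₁) = θ₀(u₁) exp(tN)`, `t ≠ 0`, and `Coinvariants.ker_eq_top_of_commute_nilpotent` applies;
    transported to `𝔔` (`FramedRep.ker_inertiaCoinvariants_eq_top_smul`).  Both sides are `1`.

Parts 1–3 are the supporting algebra: coinvariants of a plane (`Representation.…`, extending
`HasseWeilAbelianCoinvariantsProofs`), local/global inertia and Frobenius at the prime `𝔓₀` of the
completion (`DecompositionGroupOfCompletion`), and three clauses of the Grothendieck–Deligne recipe
(`IsWeilDeligneOfLadic`; Tate 1979, (4.2.1)).

## References

* H. Carayol, *Sur les représentations ℓ-adiques associées aux formes modulaires de Hilbert*,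
  Ann. Sci. ÉNS (4) 19 (1986) 409–468, Thm. (A), (0.5), (0.7), (0.8), pp. 410–411. [CarayolASENS1986]
* C. Breuil, B. Conrad, F. Diamond, R. Taylor, *On the modularity of elliptic curves over ℚ: wild
  3-adic exercises*, J. Amer. Math. Soc. 14 (2001), Thm. A. [BCDTJAMS2001]
* D. Rohrlich, *Modular curves, Hecke correspondences, and L-functions*, in: Modular Forms and
  Fermat's Last Theorem (1997), §3.1, §3.8 Thm. 5, §3.9. [Rohrlich1997]
* J. Tate, *Number theoretic background*, Proc. Sympos. Pure Math. 33.2 (Corvallis 1979), (4.1.6),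
  (4.2.1). [TateCorvallis1979]
* H. Jacquet, R. Langlands, *Automorphic forms on GL(2)*, LNM 114 (1970), Prop. 3.5. [JacquetLanglands1970]
* M. Harris, R. Taylor, Ann. of Math. Stud. 151 (2001), Thm. A. [HarrisTaylorAMS2001]
* F. Diamond, J. Shurman, *A First Course in Modular Forms*, GTM 228 (2005), Thm. 9.6.5. [DiamondShurman2005]
-/

noncomputable section


open Module Polynomial

/-! ### Part 1. Coinvariants of a plane -/

namespace Representation

open Literature.NumberTheory.EllipticCurves

variable {k : Type*} [Field k] {G : Type*} [Group G] {V : Type*} [AddCommGroup V] [Module k V]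
  [FiniteDimensional k V]

omit [FiniteDimensional k V] in
/-- If `dim V = 2`, `f e = a • e` with `a ≠ 0` and `det f = a`, then `f` moves every vector along `e`:
`f w - w ∈ k e` (in a basis `(e, y)` the matrix of `f` is `[[a, x], [0, 1]]`).  Companion of
`LinearMap.apply_eq_self_of_forall_sub_mem_span_of_det_eq_one`. [folklore] -/
theorem _root_.Literature.NumberTheory.EllipticCurves.LinearMap.sub_mem_span_of_apply_eq_smul_of_det_eq
    (h2 : finrank k V = 2) (f : V →ₗ[k] V) {e : V} (he : e ≠ 0) {a : k} (ha : a ≠ 0)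
    (hfe : f e = a • e) (hdet : LinearMap.det f = a) (w : V) : f w - w ∈ k ∙ e := by
  obtain ⟨y, hli⟩ := exists_linearIndependent_pair_of_one_lt_finrank (h2 ▸ one_lt_two) he
  let b : Module.Basis (Fin 2) k V :=
    basisOfLinearIndependentOfCardEqFinrank hli (by rw [Fintype.card_fin, h2])
  have hb0 : b 0 = e := by
    simp [b, coe_basisOfLinearIndependentOfCardEqFinrank]
  have hb1 : b 1 = y := by
    simp [b, coe_basisOfLinearIndependentOfCardEqFinrank]
  set x := b.repr (f y) 0 with hx
  set d := b.repr (f y) 1 with hd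
  have hfy : f y = x • e + d • y := by
    have := b.sum_repr (f y)
    rw [Fin.sum_univ_two, hb0, hb1] at this
    exact this.symm
  have hdet' : LinearMap.det f = a * d := by
    have hM00 : LinearMap.toMatrix b b f 0 0 = a := by
      rw [LinearMap.toMatrix_apply, hb0, hfe, ← hb0, map_smul, b.repr_self, Finsupp.smul_apply,
        Finsupp.single_eq_same, smul_eq_mul, mul_one]
    have hM10 : LinearMap.toMatrix b b f 1 0 = 0 := by
      rw [LinearMap.toMatrix_apply, hb0, hfe, ← hb0, map_smul, b.repr_self, Finsupp.smul_apply,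
        Finsupp.single_eq_of_ne (by decide), smul_zero]
    have hM11 : LinearMap.toMatrix b b f 1 1 = d := by
      rw [LinearMap.toMatrix_apply, hb1]
    rw [← LinearMap.det_toMatrix b, Matrix.det_fin_two, hM00, hM10, hM11, mul_zero, sub_zero]
  have hd1 : d = 1 := by
    rw [hdet'] at hdet
    exact mul_left_cancel₀ ha (hdet.trans (mul_one a).symm)
  have hw := b.sum_repr w
  rw [Fin.sum_univ_two, hb0, hb1] at hw
  rw [← hw, map_add, map_smul, map_smul, hfe, hfy, hd1, one_smul]
  have : b.repr w 0 • a • e + b.repr w 1 • (x • e + y) - (b.repr w 0 • e + b.repr w 1 • y) =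
      (b.repr w 0 * a + b.repr w 1 * x - b.repr w 0) • e := by
    simp only [smul_add, smul_smul, sub_smul, add_smul]
    abel
  rw [this]
  exact Submodule.smul_mem _ _ (Submodule.mem_span_singleton_self e)

/-- **The characteristic polynomial on the coinvariant line.**  Let `ρ` be a representation of `G`
on a plane `V`, `S ⊴ G`, `e ≠ 0` such that every `ρ(s)`, `s ∈ S`, moves every vector along `e`
(`ρ(s) w - w ∈ k e`) and some `ρ(s) ≠ 1`.  Then `⟨ρ(s) w - w⟩ = k e`, the coinvariants `V_S = V / k e`
form a line, and if `g ∈ G` has `ρ(g) e = a e`, `a ≠ 0`, `det ρ(g) = a c`, then `g` acts on `V_S` by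
`c`: `charpoly = X - c`.  (The determinant-one case is
`toCoinvariants_eq_smul_id_of_finrank_invariants_eq_one`.) [folklore] -/
theorem charpoly_toCoinvariants_of_line (ρ : Representation k G V) (S : Subgroup G) [S.Normal]
    (h2 : finrank k V = 2) {e : V} (he0 : e ≠ 0)
    (hline : ∀ (s : S) (w : V), ρ s w - w ∈ k ∙ e) (hram : ∃ s : S, ρ s ≠ LinearMap.id)
    (g : G) {a c : k} (ha0 : a ≠ 0) (hge : ρ g e = a • e)
    (hdetg : LinearMap.det (ρ g) = a * c) :
    (ρ.toCoinvariants S g).charpoly = X - C c := by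
  set π : Representation k S V := ρ.comp S.subtype with hπ
  have hπs : ∀ s : S, π s = ρ s := fun s => rfl
  have hle : Coinvariants.ker π ≤ k ∙ e := by
    rw [Coinvariants.ker, Submodule.span_le]
    rintro _ ⟨⟨s, v⟩, rfl⟩
    exact hline s v
  have hne : Coinvariants.ker π ≠ ⊥ := by
    intro hbot
    obtain ⟨s, hs⟩ := hram
    exact hs ((Coinvariants.ker_eq_bot_iff π).mp hbot s)
  have hker : Coinvariants.ker π = k ∙ e := by
    refine Submodule.eq_of_le_of_finrank_eq hle (le_antisymm (Submodule.finrank_mono hle) ?_)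
    rw [finrank_span_singleton he0]
    exact Submodule.one_le_finrank_iff.mpr hne
  obtain ⟨y, hli⟩ := exists_linearIndependent_pair_of_one_lt_finrank (h2 ▸ one_lt_two) he0
  let b : Module.Basis (Fin 2) k V :=
    basisOfLinearIndependentOfCardEqFinrank hli (by rw [Fintype.card_fin, h2])
  have hb0 : b 0 = e := by
    simp [b, coe_basisOfLinearIndependentOfCardEqFinrank]
  have hb1 : b 1 = y := by
    simp [b, coe_basisOfLinearIndependentOfCardEqFinrank]
  -- `ρ g y = x • e + d • y`
  set x := b.repr (ρ g y) 0 with hx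
  set d := b.repr (ρ g y) 1 with hd
  have hgy : ρ g y = x • e + d • y := by
    have := b.sum_repr (ρ g y)
    rw [Fin.sum_univ_two, hb0, hb1] at this
    exact this.symm
  -- `det ρ(g) = a d`, so `d = c`
  have hdetg' : LinearMap.det (ρ g) = a * d := by
    have hM00 : LinearMap.toMatrix b b (ρ g) 0 0 = a := by
      rw [LinearMap.toMatrix_apply, hb0, hge, ← hb0, map_smul, b.repr_self, Finsupp.smul_apply,
        Finsupp.single_eq_same, smul_eq_mul, mul_one]
    have hM10 : LinearMap.toMatrix b b (ρ g) 1 0 = 0 := by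
      rw [LinearMap.toMatrix_apply, hb0, hge, ← hb0, map_smul, b.repr_self, Finsupp.smul_apply,
        Finsupp.single_eq_of_ne (by decide), smul_zero]
    have hM11 : LinearMap.toMatrix b b (ρ g) 1 1 = d := by
      rw [LinearMap.toMatrix_apply, hb1]
    rw [← LinearMap.det_toMatrix b, Matrix.det_fin_two, hM00, hM10, hM11, mul_zero, sub_zero]
  have hdc : d = c := by
    rw [hdetg'] at hdetg
    exact mul_left_cancel₀ ha0 hdetg
  -- `g` acts on the line `V / k e` as the scalar `c`
  have hmke : Coinvariants.mk π e = 0 := (Coinvariants.mk_eq_zero π).mpr (hker ▸ Submodule.mem_span_singleton_self e)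
  have hsmul : ρ.toCoinvariants S g = c • LinearMap.id := by
    refine Coinvariants.hom_ext (LinearMap.ext fun w ↦ ?_)
    change ρ.toCoinvariants S g (Coinvariants.mk π w) = c • Coinvariants.mk π w
    rw [toCoinvariants_mk]
    change Coinvariants.mk π (ρ g w) = c • Coinvariants.mk π w
    have hw := b.sum_repr w
    rw [Fin.sum_univ_two, hb0, hb1] at hw
    rw [← hw, map_add, map_smul, map_smul, hge, hgy, hdc]
    simp only [map_add, map_smul, hmke, smul_zero, zero_add]
    rw [smul_comm]
  -- the coinvariants form a line
  have h1 : finrank k (Coinvariants π) = 1 := by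
    have hq : finrank k (Coinvariants π) + finrank k (Coinvariants.ker π) = 2 :=
      h2 ▸ Submodule.finrank_quotient_add_finrank (Coinvariants.ker π)
    rw [hker, finrank_span_singleton he0] at hq
    omega
  let b₁ : Module.Basis (Fin 1) k (Coinvariants π) := Module.finBasisOfFinrankEq k _ h1
  rw [hsmul, ← LinearMap.charpoly_toMatrix _ b₁, map_smul, LinearMap.toMatrix_id,
    Matrix.smul_one_eq_diagonal, Matrix.charpoly_diagonal, Fin.prod_univ_one]

/-- If `⟨π(g) v - v⟩ = V` the coinvariants vanish and every endomorphism of them has characteristic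
polynomial `1`. [folklore] -/
theorem charpoly_eq_one_of_ker_eq_top (π : Representation k G V) (htop : Coinvariants.ker π = ⊤)
    (f : Coinvariants π →ₗ[k] Coinvariants π) : f.charpoly = 1 := by
  have h0 : finrank k (Coinvariants π) = 0 := by
    have hq : finrank k (Coinvariants π) + finrank k (Coinvariants.ker π) = finrank k V :=
      Submodule.finrank_quotient_add_finrank (Coinvariants.ker π)
    rw [htop, finrank_top] at hq
    omega
  have hdeg : f.charpoly.natDegree = 0 := by rw [LinearMap.charpoly_natDegree, h0]
  exact Polynomial.eq_one_of_monic_natDegree_zero (LinearMap.charpoly_monic f) hdeg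

/-- **Nilpotent monodromy kills the coinvariants.**  Let `π` be a representation of `G` on a plane
`V` without invariants, `N ≠ 0` with `N² = 0` commuting with every `π(g)`, and `π(g₁) = c (1 + t N)`
for some `g₁` with `t ≠ 0`.  Then `⟨π(g) v - v⟩ = V`: the line `L = N V = ker N` lies in the kernel
(from `π(g₁) - 1`), and were the kernel the line `L`, `G` would act trivially on `V / L`, hence
(commuting with `N : V / L ≅ L`) trivially on `L`, contradicting `V^G = 0`.  (The shape of
`ρ|_{I}` for an `ℓ`-adic representation with non-zero monodromy; Tate, Corvallis 1979, (4.2.1).)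
[folklore] -/
theorem Coinvariants.ker_eq_top_of_commute_nilpotent (π : Representation k G V) (h2 : finrank k V = 2)
    (N : V →ₗ[k] V) (hN0 : N ≠ 0) (hN2 : N ∘ₗ N = 0) (hcomm : ∀ g, π g ∘ₗ N = N ∘ₗ π g)
    {g₁ : G} {c t : k} (ht : t ≠ 0) (hg₁ : π g₁ = c • LinearMap.id + (c * t) • N)
    (hfix : π.invariants = ⊥) : Coinvariants.ker π = ⊤ := by
  -- a vector `e₂` with `e₁ = N e₂ ≠ 0`; then `N e₁ = 0`
  obtain ⟨e₂, he₂⟩ : ∃ v, N v ≠ 0 := by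
    by_contra h
    push Not at h
    exact hN0 (LinearMap.ext h)
  set e₁ := N e₂ with he₁
  have hNe₁ : N e₁ = 0 := by
    rw [he₁, ← LinearMap.comp_apply, hN2, LinearMap.zero_apply]
  -- `e₁ ∈ ker`
  have hg₁e₁ : π g₁ e₁ - e₁ = (c - 1) • e₁ := by
    rw [hg₁]
    simp only [LinearMap.add_apply, LinearMap.smul_apply, LinearMap.id_apply, hNe₁, smul_zero, add_zero,
      sub_smul, one_smul]
  have hg₁e₂ : π g₁ e₂ - e₂ = (c - 1) • e₂ + (c * t) • e₁ := by
    rw [hg₁]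
    simp only [LinearMap.add_apply, LinearMap.smul_apply, LinearMap.id_apply, sub_smul, one_smul, ← he₁]
    abel
  have he₁K : e₁ ∈ Coinvariants.ker π := by
    by_cases hc : c = 1
    · have h := Coinvariants.sub_mem_ker (ρ := π) g₁ e₂
      rw [hg₁e₂, hc, sub_self, zero_smul, zero_add, one_mul] at h
      exact (Submodule.smul_mem_iff _ ht).mp h
    · have h := Coinvariants.sub_mem_ker (ρ := π) g₁ e₁
      rw [hg₁e₁] at h
      exact (Submodule.smul_mem_iff _ (sub_ne_zero.mpr hc)).mp h
  -- if `ker ≠ ⊤` it is the line `k e₁`, `G` acts trivially on `V / k e₁`, and `e₁` is fixed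
  by_contra htop
  have hlt : finrank k (Coinvariants.ker π) < 2 := h2 ▸ Submodule.finrank_lt htop
  have hle : (k ∙ e₁) ≤ Coinvariants.ker π := (Submodule.span_singleton_le_iff_mem _ _).mpr he₁K
  have hker : Coinvariants.ker π = k ∙ e₁ := by
    refine (Submodule.eq_of_le_of_finrank_eq hle (le_antisymm (Submodule.finrank_mono hle) ?_)).symm
    have h1 : 1 ≤ finrank k (k ∙ e₁) := by rw [finrank_span_singleton he₂]
    omega
  have hfixed : ∀ g, π g e₁ = e₁ := by
    intro g
    obtain ⟨s, hs⟩ := Submodule.mem_span_singleton.mp (hker ▸ Coinvariants.sub_mem_ker (ρ := π) g e₂)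
    have hge₂ : π g e₂ = s • e₁ + e₂ := by rw [hs, sub_add_cancel]
    calc π g e₁ = N (π g e₂) := by rw [he₁, ← LinearMap.comp_apply, hcomm g, LinearMap.comp_apply]
      _ = e₁ := by rw [hge₂, map_add, map_smul, hNe₁, smul_zero, zero_add]
  have hmem : e₁ ∈ π.invariants := (π.mem_invariants e₁).mpr hfixed
  rw [hfix, Submodule.mem_bot] at hmem
  exact he₂ hmem

omit [FiniteDimensional k V] in
/-- **A finite image with no invariants kills the coinvariants** (Maschke by averaging, char. `0`):
if `π(G)` is finite and `V^G = 0` then `⟨π(g) v - v⟩ = V`, since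
`|π(G)| v = ∑_{u ∈ π(G)} (v - u v) + ∑_{u ∈ π(G)} u v` and the `G`-invariant average `∑ u v` vanishes.
[folklore] -/
theorem Coinvariants.ker_eq_top_of_finite [CharZero k] (π : Representation k G V)
    (hfin : (Set.range fun g : G => π g).Finite) (hfix : π.invariants = ⊥) :
    Coinvariants.ker π = ⊤ := by
  classical
  set T : Finset (V →ₗ[k] V) := hfin.toFinset with hT
  have hmemT : ∀ {u}, u ∈ T ↔ ∃ g, π g = u := fun {u} => by
    rw [hT, Set.Finite.mem_toFinset, Set.mem_range]
  have h1T : (1 : V →ₗ[k] V) ∈ T := hmemT.mpr ⟨1, map_one π⟩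
  -- left multiplication by `π g₀` permutes `T`
  have himage : ∀ g₀ : G, T.image (fun u => π g₀ * u) = T := by
    intro g₀
    have hinj : Function.Injective (fun u : V →ₗ[k] V => π g₀ * u) := by
      intro u u' h
      have h' := congrArg (fun f => π g₀⁻¹ * f) h
      simpa only [← mul_assoc, ← map_mul, inv_mul_cancel, map_one, one_mul] using h'
    refine Finset.eq_of_subset_of_card_le (fun u hu => ?_) ?_
    · obtain ⟨u', hu', rfl⟩ := Finset.mem_image.mp hu
      obtain ⟨g, rfl⟩ := hmemT.mp hu'
      exact hmemT.mpr ⟨g₀ * g, map_mul π g₀ g⟩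
    · rw [Finset.card_image_of_injective _ hinj]
  -- the average `∑_{u ∈ T} u v` is invariant, hence zero
  have havg : ∀ v : V, ∑ u ∈ T, u v = 0 := by
    intro v
    have hinv : ∑ u ∈ T, u v ∈ π.invariants := by
      rw [mem_invariants]
      intro g₀
      rw [map_sum]
      have hinj : Function.Injective (fun u : V →ₗ[k] V => π g₀ * u) := by
        intro u u' h
        have h' := congrArg (fun f => π g₀⁻¹ * f) h
        simpa only [← mul_assoc, ← map_mul, inv_mul_cancel, map_one, one_mul] using h'
      calc ∑ u ∈ T, π g₀ (u v) = ∑ u ∈ T, (π g₀ * u) v := rfl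
        _ = ∑ u ∈ T.image (fun u => π g₀ * u), u v :=
            (Finset.sum_image (f := fun u : V →ₗ[k] V => u v) fun u _ u' _ h => hinj h).symm
        _ = ∑ u ∈ T, u v := by rw [himage g₀]
    rw [hfix, Submodule.mem_bot] at hinv
    exact hinv
  -- so `|T| • v = ∑ (v - u v) ∈ ker`
  rw [eq_top_iff]
  intro v _
  have hsum : ∑ u ∈ T, (v - u v) ∈ Coinvariants.ker π := by
    refine Submodule.sum_mem _ fun u hu => ?_
    obtain ⟨g, rfl⟩ := hmemT.mp hu
    have h := Coinvariants.sub_mem_ker (ρ := π) g v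
    rw [← neg_sub]
    exact Submodule.neg_mem _ h
  rw [Finset.sum_sub_distrib, havg v, sub_zero, Finset.sum_const] at hsum
  have hcard : (T.card : k) ≠ 0 := Nat.cast_ne_zero.mpr (Finset.card_pos.mpr ⟨1, h1T⟩).ne'
  have h := Submodule.smul_mem _ ((T.card : k)⁻¹) hsum
  rwa [← Nat.cast_smul_eq_nsmul k, smul_smul, inv_mul_cancel₀ hcard, one_smul] at h

end Representation


open scoped MatrixGroups Matrix NumberField
open Matrix IsDedekindDomain Field NumberField Polynomial

/-! ### Part 2. Local and global inertia / Frobenius at the prime of the completion -/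

namespace Literature.NumberTheory.GaloisRepresentations

open IsNonarchimedeanLocalField Literature.NumberTheory.Automorphic

section Completion

variable (K : Type) [Field K] [NumberField K] (v : HeightOneSpectrum (𝓞 K))

/-- Every element of `I_{𝔓₀}` is `res u` for some `u` in the inertia group of the Weil group of
`K_v` (`I_{𝔓₀} = res I_{K_v}`, `inertia_adicCompletionPrime_eq_map_absInertia`, and `I_{K_v} ≤ W_{K_v}`).
[cite: NeukirchANT1999, Ch. II §9 Prop. (9.6)] -/
theorem exists_mem_inertia_absGaloisRestrict_toAbsGalois_eq {τ : absoluteGaloisGroup K}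
    (hτ : τ ∈ (adicCompletionPrime K v).inertia (absoluteGaloisGroup K)) :
    ∃ u ∈ WeilGroup.inertia (v.adicCompletion K),
      absGaloisRestrict K (v.adicCompletion K) (WeilGroup.toAbsGalois _ u) = τ := by
  rw [inertia_adicCompletionPrime_eq_map_absInertia] at hτ
  obtain ⟨s, hs, rfl⟩ := Subgroup.mem_map.mp hτ
  exact ⟨⟨s, absInertia_le_weilSubgroup _ hs⟩, WeilGroup.mem_inertia_iff.mpr hs, rfl⟩

/-- `res u ∈ I_{𝔓₀}` for `u` in the inertia group of the Weil group of `K_v`.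
[cite: NeukirchANT1999, Ch. II §9 Prop. (9.6)] -/
theorem absGaloisRestrict_toAbsGalois_mem_inertia {u : WeilGroup (v.adicCompletion K)}
    (hu : u ∈ WeilGroup.inertia (v.adicCompletion K)) :
    absGaloisRestrict K (v.adicCompletion K) (WeilGroup.toAbsGalois _ u) ∈
      (adicCompletionPrime K v).inertia (absoluteGaloisGroup K) := by
  rw [inertia_adicCompletionPrime_eq_map_absInertia]
  exact Subgroup.mem_map_of_mem _ (WeilGroup.mem_inertia_iff.mp hu)

/-- Every arithmetic Frobenius at `𝔓₀` is `res W` for an element `W` of degree `1` of the Weil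
group of `K_v` (`D_{𝔓₀} = res Γ_{K_v}`, Frobenius at `𝔓₀` ↔ Frobenius of `K_v`).
[cite: NeukirchANT1999, Ch. II §9 Prop. (9.6)] [cite: TateCorvallis1979, (1.4.1)] -/
theorem exists_deg_eq_one_absGaloisRestrict_toAbsGalois_eq {σ : absoluteGaloisGroup K}
    (hσ : IsArithFrobAt (𝓞 K) σ (adicCompletionPrime K v)) :
    ∃ W : WeilGroup (v.adicCompletion K), WeilGroup.deg W = 1 ∧
      absGaloisRestrict K (v.adicCompletion K) (WeilGroup.toAbsGalois _ W) = σ := by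
  have hq : residueFieldCard (v.adicCompletion K) = Nat.card (𝓞 K ⧸ v.asIdeal) := by
    rw [residueFieldCard_adicCompletion_eq K v, HeightOneSpectrum.residueCard_eq_card_quotient]
  have hD : σ ∈ (adicCompletionPrime K v).decompositionSubgroup (absoluteGaloisGroup K) :=
    hσ.mem_stabilizer
  rw [decompositionSubgroup_adicCompletionPrime_eq_range] at hD
  obtain ⟨φ, rfl⟩ := hD
  have hφ : IsFrobPow φ 1 := isFrobPow_one_iff_isAbsArithFrob_holds.mpr
    ((isArithFrobAt_absGaloisRestrict_adicCompletionPrime_iff K v hq φ).mp hσ)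
  exact ⟨WeilGroup.mk φ ⟨1, hφ⟩, WeilGroup.deg_eq_iff'.mpr (by rw [WeilGroup.toAbsGalois_mk]; exact hφ), rfl⟩

end Completion

/-! ### Part 3. Three more clauses of the Grothendieck–Deligne recipe -/

section Ladic

variable {F : Type*} [Field F] [ValuativeRel F] [TopologicalSpace F] [IsNonarchimedeanLocalField F]
variable {E : Type*} [Field E] [CharZero E] {n : ℕ}
  {ρW : WeilGroup F →* GL (Fin n) E} {rv : WeilDeligneRep F E (Fin n → E)}

/-- On inertia `ρW(u) = ρ_WD(u) · exp(c N)` for some scalar `c` (the clause `m = 0`).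
Tate, Corvallis 1979, (4.2.1). [cite: TateCorvallis1979, (4.2.1)] -/
theorem IsWeilDeligneOfLadic.exists_coe_eq_mul_exp (h : IsWeilDeligneOfLadic ρW rv)
    {u : WeilGroup F} (hu : u ∈ WeilGroup.inertia F) :
    ∃ c : E, ((ρW u : GL (Fin n) E) : Matrix (Fin n) (Fin n) E) =
      LinearMap.toMatrix' (rv.ρ u) * IsNilpotent.exp (c • LinearMap.toMatrix' rv.N) := by
  obtain ⟨t, U, Φ₀, -, -, -, -, -, hρ⟩ := h
  refine ⟨(t ⟨u, hu⟩).toAdd, ?_⟩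
  have hNil : IsNilpotent ((t ⟨u, hu⟩).toAdd • LinearMap.toMatrix' rv.N) :=
    (rv.isNilpotent_N.map LinearMap.toMatrixAlgEquiv').smul _
  have h0 := hρ 0 ⟨u, hu⟩
  rw [zpow_zero, one_mul] at h0
  change LinearMap.toMatrix' (rv.ρ u) = ((ρW u : GL (Fin n) E) : Matrix (Fin n) (Fin n) E) *
    IsNilpotent.exp (-((t ⟨u, hu⟩).toAdd • LinearMap.toMatrix' rv.N)) at h0
  rw [h0, mul_assoc, IsNilpotent.exp_neg_mul_exp_self hNil, mul_one]

/-- Some inertia element acts through `ρW` as `exp(c N)` with `c ≠ 0` (the clauses "`ρW = exp(tN)`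
on `U`" and "`t` non-trivial on `U`").  Tate, Corvallis 1979, (4.2.1); Deligne 1973, §8.4.2.
[cite: TateCorvallis1979, (4.2.1)] -/
theorem IsWeilDeligneOfLadic.exists_coe_eq_exp (h : IsWeilDeligneOfLadic ρW rv) :
    ∃ u ∈ WeilGroup.inertia F, ∃ c : E, c ≠ 0 ∧ ((ρW u : GL (Fin n) E) : Matrix (Fin n) (Fin n) E) =
      IsNilpotent.exp (c • LinearMap.toMatrix' rv.N) := by
  obtain ⟨t, U, Φ₀, hU, -, -, ⟨u, huU, htu⟩, hexp, -⟩ := h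
  refine ⟨u, u.2, (t u).toAdd, fun h0 => htu ?_, hexp u huU⟩
  rwa [toAdd_eq_zero] at h0

/-- With `N = 0` the recipe returns `ρW` itself on inertia: `ρW(u) = ρ_WD(u)`.
Tate, Corvallis 1979, (4.2.1). [cite: TateCorvallis1979, (4.2.1)] -/
theorem IsWeilDeligneOfLadic.coe_eq_toMatrix'_of_N_eq_zero (h : IsWeilDeligneOfLadic ρW rv)
    (hN : rv.N = 0) {u : WeilGroup F} (hu : u ∈ WeilGroup.inertia F) :
    ((ρW u : GL (Fin n) E) : Matrix (Fin n) (Fin n) E) = LinearMap.toMatrix' (rv.ρ u) := by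
  obtain ⟨c, hc⟩ := h.exists_coe_eq_mul_exp hu
  rw [hc, hN, map_zero, smul_zero, IsNilpotent.exp_zero, mul_one]

/-- `ρ_WD(u)` commutes with `N` for `u` in inertia, in matrices. [cite: TateCorvallis1979, (4.1.2)] -/
theorem WeilDeligneRep.toMatrix'_ρ_mul_toMatrix'_N (r : WeilDeligneRep F E (Fin n → E)) {u : WeilGroup F}
    (hu : u ∈ WeilGroup.inertia F) :
    LinearMap.toMatrix' (r.ρ u) * LinearMap.toMatrix' r.N = LinearMap.toMatrix' r.N * LinearMap.toMatrix' (r.ρ u) := by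
  have h := r.conj_N u
  rw [(WeilGroup.deg_eq_zero_iff_mem_inertia IsFrobPow.mul_holds IsFrobPow.unique_holds).mpr hu, zpow_zero,
    one_smul] at h
  rw [← LinearMap.toMatrix'_comp, h, LinearMap.toMatrix'_comp]

end Ladic

/-! ### Part 3b. Inertia coinvariants of a framed plane representation: the line and the zero cases -/

section Framed

open scoped Pointwise

variable {G : Type*} [Group G] [TopologicalSpace G] {K : Type*} [Field K] [TopologicalSpace K]
  [IsTopologicalRing K] {S : Type*} [CommRing S] [MulSemiringAction G S]

/-- **The coinvariant line of a framed plane representation.**  Let `ρ : G → GL₂(K)`, `𝔔` a prime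
(of a `G`-ring `S`), `x' ≠ 0` a vector with `ρ(u) x' = θ(u) x'` and `det ρ(u) = θ(u)` for `u ∈ I_𝔔`,
`dim V^{I_𝔔} = 1`, and `σ ∈ D_𝔔` with `ρ(σ) x' = a x'`, `a ≠ 0`, `det ρ(σ) = a c`.  Then the
characteristic polynomial of `σ` on the inertia coinvariants `V_{I_𝔔}` is `X - c`
(`charpoly_toCoinvariants_of_line`: inertia moves every vector along `x'` and acts non-trivially).
[folklore] -/
theorem FramedRep.charpoly_toInertiaCoinvariants_of_eigenvector (ρ : FramedRep G K 2) (𝔔 : Ideal S)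
    (σ : 𝔔.decompositionSubgroup G) {x' : Fin 2 → K} (hx'0 : x' ≠ 0) (θ : G → K) (hθ0 : ∀ γ, θ γ ≠ 0)
    (hρI : ∀ u ∈ 𝔔.inertia G, ((ρ u : GL (Fin 2) K) : Matrix (Fin 2) (Fin 2) K) *ᵥ x' = θ u • x')
    (hdetI : ∀ u ∈ 𝔔.inertia G, ((ρ u : GL (Fin 2) K) : Matrix (Fin 2) (Fin 2) K).det = θ u)
    {a c : K} (ha : a ≠ 0)
    (hρF : ((ρ (σ : G) : GL (Fin 2) K) : Matrix (Fin 2) (Fin 2) K) *ᵥ x' = a • x')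
    (hdetF : ((ρ (σ : G) : GL (Fin 2) K) : Matrix (Fin 2) (Fin 2) K).det = a * c)
    (h1 : Module.finrank K (ρ.toContinuousRep.fixedSubmodule (𝔔.inertia G)) = 1) :
    (ρ.toContinuousRep.toInertiaCoinvariants 𝔔 σ).charpoly = X - C c := by
  set ρD : Representation K (𝔔.decompositionSubgroup G) (Fin 2 → K) :=
    ρ.toContinuousRep.restrictDecomposition 𝔔 with hρD
  have hρD_apply : ∀ (γ : 𝔔.decompositionSubgroup G) (v : Fin 2 → K),
      ρD γ v = ((ρ (γ : G) : GL (Fin 2) K) : Matrix (Fin 2) (Fin 2) K) *ᵥ v := fun γ v => rfl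
  have hρD_lin : ∀ γ : 𝔔.decompositionSubgroup G,
      ρD γ = Matrix.toLin' ((ρ (γ : G) : GL (Fin 2) K) : Matrix (Fin 2) (Fin 2) K) :=
    fun γ => LinearMap.ext fun v => by rw [hρD_apply, Matrix.toLin'_apply]
  have h2 : Module.finrank K (Fin 2 → K) = 2 := Module.finrank_fin_fun K
  have hSmem : ∀ s : 𝔔.inertia (𝔔.decompositionSubgroup G),
      ((s : 𝔔.decompositionSubgroup G) : G) ∈ 𝔔.inertia G := fun s => Ideal.coe_mem_inertia.mpr s.2
  have hline : ∀ (s : 𝔔.inertia (𝔔.decompositionSubgroup G)) (v : Fin 2 → K),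
      ρD (s : 𝔔.decompositionSubgroup G) v - v ∈ K ∙ x' := by
    intro s v
    refine Literature.NumberTheory.EllipticCurves.LinearMap.sub_mem_span_of_apply_eq_smul_of_det_eq h2
      (ρD (s : 𝔔.decompositionSubgroup G)) hx'0 (hθ0 ((s : 𝔔.decompositionSubgroup G) : G)) ?_ ?_ v
    · rw [hρD_apply]
      exact hρI _ (hSmem s)
    · rw [hρD_lin, LinearMap.det_toLin']
      exact hdetI _ (hSmem s)
  have hram : ∃ s : 𝔔.inertia (𝔔.decompositionSubgroup G), ρD (s : 𝔔.decompositionSubgroup G) ≠ LinearMap.id := by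
    refine not_forall.mp fun hall => ?_
    have htop : Representation.invariants (ρD.comp (𝔔.inertia (𝔔.decompositionSubgroup G)).subtype) = ⊤ :=
      (Representation.invariants_eq_top_iff_forall_eq_id _).mpr hall
    rw [hρD, ContinuousRep.invariants_restrictDecomposition_comp_inertia] at htop
    rw [htop, finrank_top, Module.finrank_fin_fun] at h1
    exact absurd h1 (by norm_num)
  have hge : ρD σ x' = a • x' := by
    rw [hρD_apply]
    exact hρF
  have hdetg : LinearMap.det (ρD σ) = a * c := by rw [hρD_lin, LinearMap.det_toLin', hdetF]
  exact Representation.charpoly_toCoinvariants_of_line ρD (𝔔.inertia (𝔔.decompositionSubgroup G)) h2 hx'0 hline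
    hram σ ha hge hdetg

/-- On zero inertia coinvariants every characteristic polynomial is `1`. [folklore] -/
theorem FramedRep.charpoly_toInertiaCoinvariants_eq_one {n : ℕ} (ρ : FramedRep G K n) (𝔔 : Ideal S)
    (σ : 𝔔.decompositionSubgroup G)
    (h : Representation.Coinvariants.ker ((ρ.toContinuousRep.restrictDecomposition 𝔔).comp
      (𝔔.inertia (𝔔.decompositionSubgroup G)).subtype) = ⊤) :
    (ρ.toContinuousRep.toInertiaCoinvariants 𝔔 σ).charpoly = 1 :=
  Representation.charpoly_eq_one_of_ker_eq_top _ h _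

/-- **Zero inertia coinvariants move along conjugation**: if `⟨ρ(u) v - v : u ∈ I_𝔓⟩ = V` then the
same holds at `τ • 𝔓` (`I_{τ • 𝔓} = τ I_𝔓 τ⁻¹`, and `ρ(τ)` maps the generators at `𝔓` to generators at
`τ • 𝔓`).  Serre, *Facteurs locaux* (1970), §2.3 (functoriality). [folklore] -/
theorem FramedRep.ker_inertiaCoinvariants_eq_top_smul {n : ℕ} (ρ : FramedRep G K n) (𝔓 : Ideal S) (τ : G)
    (h : Representation.Coinvariants.ker ((ρ.toContinuousRep.restrictDecomposition 𝔓).comp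
      (𝔓.inertia (𝔓.decompositionSubgroup G)).subtype) = ⊤) :
    Representation.Coinvariants.ker ((ρ.toContinuousRep.restrictDecomposition (τ • 𝔓)).comp
      ((τ • 𝔓).inertia ((τ • 𝔓).decompositionSubgroup G)).subtype) = ⊤ := by
  rw [eq_top_iff]
  rintro v -
  have key : ∀ y ∈ Representation.Coinvariants.ker ((ρ.toContinuousRep.restrictDecomposition 𝔓).comp
      (𝔓.inertia (𝔓.decompositionSubgroup G)).subtype),
      ((ρ τ : GL (Fin n) K) : Matrix (Fin n) (Fin n) K) *ᵥ y ∈ Representation.Coinvariants.ker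
        ((ρ.toContinuousRep.restrictDecomposition (τ • 𝔓)).comp
          ((τ • 𝔓).inertia ((τ • 𝔓).decompositionSubgroup G)).subtype) := by
    intro y hy
    induction hy using Submodule.span_induction with
    | mem z hz =>
      obtain ⟨⟨s, v⟩, rfl⟩ := hz
      have hs : ((s : 𝔓.decompositionSubgroup G) : G) ∈ 𝔓.inertia G := Ideal.coe_mem_inertia.mpr s.2
      have hs' : τ * (s : G) * τ⁻¹ ∈ (τ • 𝔓).inertia G := (Ideal.conj_mem_inertia_smul_iff 𝔓 τ _).mpr hs
      have hD' : τ * (s : G) * τ⁻¹ ∈ (τ • 𝔓).decompositionSubgroup G := Ideal.inertia_le_decompositionSubgroup _ _ hs'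
      have hmem := Representation.Coinvariants.sub_mem_ker
        (ρ := (ρ.toContinuousRep.restrictDecomposition (τ • 𝔓)).comp
          ((τ • 𝔓).inertia ((τ • 𝔓).decompositionSubgroup G)).subtype)
        ⟨⟨τ * (s : G) * τ⁻¹, hD'⟩, Ideal.coe_mem_inertia.mp hs'⟩ (((ρ τ : GL (Fin n) K) : Matrix (Fin n) (Fin n) K) *ᵥ v)
      have e1 : ((ρ τ : GL (Fin n) K) : Matrix (Fin n) (Fin n) K) *ᵥ
          (((ρ (s : G) : GL (Fin n) K) : Matrix (Fin n) (Fin n) K) *ᵥ v - v) =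
          ((ρ (τ * (s : G) * τ⁻¹) : GL (Fin n) K) : Matrix (Fin n) (Fin n) K) *ᵥ
            (((ρ τ : GL (Fin n) K) : Matrix (Fin n) (Fin n) K) *ᵥ v) -
            ((ρ τ : GL (Fin n) K) : Matrix (Fin n) (Fin n) K) *ᵥ v := by
        rw [Matrix.mulVec_sub, Matrix.mulVec_mulVec, Matrix.mulVec_mulVec, ← Matrix.GeneralLinearGroup.coe_mul,
          ← Matrix.GeneralLinearGroup.coe_mul, ← map_mul, ← map_mul,
          show τ * (s : G) * τ⁻¹ * τ = τ * (s : G) by group]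
      change ((ρ τ : GL (Fin n) K) : Matrix (Fin n) (Fin n) K) *ᵥ
          (((ρ (s : G) : GL (Fin n) K) : Matrix (Fin n) (Fin n) K) *ᵥ v - v) ∈ _
      rw [e1]
      exact hmem
    | zero => rw [Matrix.mulVec_zero]; exact Submodule.zero_mem _
    | add y z _ _ hy hz => rw [Matrix.mulVec_add]; exact Submodule.add_mem _ hy hz
    | smul a y _ hy => rw [Matrix.mulVec_smul]; exact Submodule.smul_mem _ a hy
  have hv : ((ρ τ⁻¹ : GL (Fin n) K) : Matrix (Fin n) (Fin n) K) *ᵥ v ∈ Representation.Coinvariants.ker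
      ((ρ.toContinuousRep.restrictDecomposition 𝔓).comp (𝔓.inertia (𝔓.decompositionSubgroup G)).subtype) :=
    h ▸ Submodule.mem_top
  have h2 := key _ hv
  rwa [Matrix.mulVec_mulVec, ← Matrix.GeneralLinearGroup.coe_mul, ← map_mul, mul_inv_cancel, map_one, Units.val_one,
    Matrix.one_mulVec] at h2

/-- **Nilpotent monodromy at `I_𝔓` kills the coinvariants** (Galois form of
`Coinvariants.ker_eq_top_of_commute_nilpotent`): if every `ρ(u)`, `u ∈ I_𝔓`, commutes with a non-zero
`N` with `N² = 0`, some `ρ(u₁) = c (1 + tN)` with `t ≠ 0`, and `V^{I_𝔓} = 0`, then `V_{I_𝔓} = 0`.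
[folklore] -/
theorem FramedRep.ker_inertiaCoinvariants_eq_top_of_nilpotent (ρ : FramedRep G K 2) (𝔓 : Ideal S)
    (Nm : Matrix (Fin 2) (Fin 2) K) (hN0 : Nm ≠ 0) (hN2 : Nm * Nm = 0)
    (hcomm : ∀ u ∈ 𝔓.inertia G, ((ρ u : GL (Fin 2) K) : Matrix (Fin 2) (Fin 2) K) * Nm =
      Nm * ((ρ u : GL (Fin 2) K) : Matrix (Fin 2) (Fin 2) K))
    {u₁ : G} (hu₁ : u₁ ∈ 𝔓.inertia G) {c t : K} (ht : t ≠ 0)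
    (hρu₁ : ((ρ u₁ : GL (Fin 2) K) : Matrix (Fin 2) (Fin 2) K) = c • (1 + t • Nm))
    (hfix : ρ.toContinuousRep.fixedSubmodule (𝔓.inertia G) = ⊥) :
    Representation.Coinvariants.ker ((ρ.toContinuousRep.restrictDecomposition 𝔓).comp
      (𝔓.inertia (𝔓.decompositionSubgroup G)).subtype) = ⊤ := by
  set π : Representation K (𝔓.inertia (𝔓.decompositionSubgroup G)) (Fin 2 → K) :=
    (ρ.toContinuousRep.restrictDecomposition 𝔓).comp (𝔓.inertia (𝔓.decompositionSubgroup G)).subtype with hπ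
  have hπlin : ∀ s : 𝔓.inertia (𝔓.decompositionSubgroup G),
      π s = Matrix.toLin' (((ρ ((s : 𝔓.decompositionSubgroup G) : G)) : GL (Fin 2) K) : Matrix (Fin 2) (Fin 2) K) :=
    fun s => LinearMap.ext fun v => by rw [Matrix.toLin'_apply]; rfl
  have hSmem : ∀ s : 𝔓.inertia (𝔓.decompositionSubgroup G),
      ((s : 𝔓.decompositionSubgroup G) : G) ∈ 𝔓.inertia G := fun s => Ideal.coe_mem_inertia.mpr s.2
  let s₁ : 𝔓.inertia (𝔓.decompositionSubgroup G) :=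
    ⟨⟨u₁, Ideal.inertia_le_decompositionSubgroup _ _ hu₁⟩, Ideal.coe_mem_inertia.mp hu₁⟩
  refine Representation.Coinvariants.ker_eq_top_of_commute_nilpotent π (Module.finrank_fin_fun K) (Matrix.toLin' Nm)
    ?_ ?_ (fun s => ?_) (g₁ := s₁) (c := c) (t := t) ht ?_ ?_
  · exact fun h0 => hN0 (Matrix.toLin'.injective (by rw [h0, map_zero]))
  · rw [← Matrix.toLin'_mul, hN2, map_zero]
  · rw [hπlin, ← Matrix.toLin'_mul, hcomm _ (hSmem s), Matrix.toLin'_mul]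
  · rw [hπlin]
    change Matrix.toLin' (((ρ u₁) : GL (Fin 2) K) : Matrix (Fin 2) (Fin 2) K) = _
    rw [hρu₁, map_smul, map_add, Matrix.toLin'_one, map_smul, smul_add, smul_smul]
  · rw [hπ, ContinuousRep.invariants_restrictDecomposition_comp_inertia, hfix]

/-- **A finite inertia image without invariants kills the coinvariants** (Galois form of
`Coinvariants.ker_eq_top_of_finite`). [folklore] -/
theorem FramedRep.ker_inertiaCoinvariants_eq_top_of_finite [CharZero K] {n : ℕ} (ρ : FramedRep G K n) (𝔓 : Ideal S)
    (hfin : ((fun u : G => ((ρ u : GL (Fin n) K) : Matrix (Fin n) (Fin n) K)) '' (𝔓.inertia G : Set G)).Finite)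
    (hfix : ρ.toContinuousRep.fixedSubmodule (𝔓.inertia G) = ⊥) :
    Representation.Coinvariants.ker ((ρ.toContinuousRep.restrictDecomposition 𝔓).comp
      (𝔓.inertia (𝔓.decompositionSubgroup G)).subtype) = ⊤ := by
  set π : Representation K (𝔓.inertia (𝔓.decompositionSubgroup G)) (Fin n → K) :=
    (ρ.toContinuousRep.restrictDecomposition 𝔓).comp (𝔓.inertia (𝔓.decompositionSubgroup G)).subtype with hπ
  have hπlin : ∀ s : 𝔓.inertia (𝔓.decompositionSubgroup G),
      π s = Matrix.toLin' (((ρ ((s : 𝔓.decompositionSubgroup G) : G)) : GL (Fin n) K) : Matrix (Fin n) (Fin n) K) :=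
    fun s => LinearMap.ext fun v => by rw [Matrix.toLin'_apply]; rfl
  refine Representation.Coinvariants.ker_eq_top_of_finite π ?_ ?_
  · refine (hfin.image Matrix.toLin').subset ?_
    rintro _ ⟨s, rfl⟩
    exact ⟨_, ⟨((s : 𝔓.decompositionSubgroup G) : G), Ideal.coe_mem_inertia.mpr s.2, rfl⟩, (hπlin s).symm⟩
  · rw [hπ, ContinuousRep.invariants_restrictDecomposition_comp_inertia, hfix]

end Framed

end Literature.NumberTheory.GaloisRepresentations


/-! ### Part 4. The local–global package at `w ∣ ℓ`, `ℓ ∣ N`, `ℓ ≠ p` -/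

namespace Literature.NumberTheory.EllipticCurves

open scoped ModularForm Classical
open CongruenceSubgroup Filter MeasureTheory
open Literature.NumberTheory.EllipticCurves.ModularForms Literature.NumberTheory.EllipticCurves.Hida2000Thm326
open Literature.NumberTheory.GaloisRepresentations Literature.NumberTheory.Automorphic
open Rat.HeightOneSpectrum UpperHalfPlane

section Package

open scoped Valued
open ValuativeRel

variable {N : ℕ} [NeZero N] {k : ℤ}

/-- `ℓ^{-(k-1)/2} · (a / (√ℓ)^{k-2}) / ℓ · √ℓ = a / ℓ^{k-1}`: the `U_ℓ`-eigenvalue of the new vector of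
`π_g ⊗ |det|^{(k-1)/2}`, read through `one_sub_C_mul_X_dvd_of_hasRSLFactor_of_localComponent`, is
`a_ℓ(g) ℓ^{1-k}`. [folklore] -/
theorem detTwist_eigenvalue_div_mul_sqrt {ℓ : ℕ} (hℓ : ℓ ≠ 0) {k : ℤ} {m : ℕ} (hm : ((m : ℕ) : ℤ) = k - 1)
    (a : ℂ) :
    (ℓ : ℂ) ^ (-((((k : ℝ) - 1) / 2 : ℝ) : ℂ)) * (a / ((Real.sqrt ℓ : ℝ) : ℂ) ^ (k - 2)) / (ℓ : ℂ) *
        ((Real.sqrt ℓ : ℝ) : ℂ) = a / (ℓ : ℂ) ^ m := by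
  set S : ℂ := ((Real.sqrt ℓ : ℝ) : ℂ) with hS
  have hS0 : S ≠ 0 := by
    rw [hS, Ne, Complex.ofReal_eq_zero]
    exact (Real.sqrt_pos.2 (Nat.cast_pos.2 (Nat.pos_of_ne_zero hℓ))).ne'
  have hS2 : S ^ 2 = (ℓ : ℂ) := by
    rw [hS, ← Complex.ofReal_pow, Real.sq_sqrt (Nat.cast_nonneg ℓ), Complex.ofReal_natCast]
  have hk2 : k - 2 = (m : ℤ) - 1 := by omega
  rw [natCast_cpow_neg_half_weight' hm.symm, ← hS, hk2, zpow_sub_one₀ hS0, zpow_natCast, ← hS2, ← pow_mul]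
  field_simp
  ring

/-- **The local–global package of a newform at a prime `ℓ ∣ N`, `ℓ ≠ p`.**  Let `g ∈ S_k(Γ₁(N))`,
`k ≥ 2`, be a newform, `ρ : Γ_ℚ → GL₂(ℚ̄_p)` irreducible and attached to `g` away from `Np`,
`ℓ ∣ N` a prime `≠ p` and `w` the place of `ℚ` at `ℓ`.  Then (from the tree's local–global carrier
`galoisRep_GL2_totallyReal_localGlobal`, applied to `π = π_g ⊗ |det|^{(k-1)/2}` and
`r = ρ ⊗ θ₀⁻¹`, `θ₀ = ι⁻¹ ∘ ε ∘ χ_N`, exactly as in `inertia_of_level_of_localGlobal'`):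
there are `θ₀`, `r` with `ρ = θ₀ · r`, a Weil–Deligne representation `r_w` attached to
`r|_{W_{ℚ_w}}` by the Grothendieck–Deligne recipe, its transport `ι(r_w)`, and
`(1 - a_ℓ(g) ℓ^{1-k} X) ∣ det(1 - TΦ | (ker N)^I)` for `ι(r_w)`: the Euler factor of `ι(r_w)` is
that of `ι(r_w)^{F-ss} ∈ rec(π_w)` (`eulerFactor_eq_of_isFrobSemisimplificationOf`), hence the
JPSS `L`-polynomial `P₀` of the pair `(π_w, 𝟙)` (clause (iii-L) of the datum and
`eulerFactor_tprod_out_eq_of_hasClass`), which the pole of the new vector divides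
(`one_sub_C_mul_X_dvd_of_hasRSLFactor_of_localComponent`; the `U_w`-eigenvalue of the new vector of
`π` is `ℓ^{-(k-1)/2} a_ℓ/(√ℓ)^{k-2}`, `exists_detTwist_datum`).
[cite: CarayolASENS1986, Thm. (A) (0.7) with (0.5), (0.8), pp. 410–411]
[cite: JacquetLanglands1970, Prop. 3.5] [cite: HarrisTaylorAMS2001, Thm. A (ii), (v)] -/
theorem exists_twist_weilDeligne_dvd (hLG : galoisRep_GL2_totallyReal_localGlobal)
    (g : CuspForm (Gamma1 N) k) (hk : 2 ≤ k) (hg : IsNewform1 g)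
    (p : ℕ) [Fact p.Prime] (ι : PadicAlgCl p ≃+* ℂ) (ρ : FramedGaloisRep ℚ (PadicAlgCl p) 2)
    (hρ : IsGaloisRepOfNewform1 g
      ((ι.symm : ℂ →+* PadicAlgCl p).comp (algebraMap (coeffCharField g) ℂ)) {q | q ∣ N * p} ρ)
    (hirr : ρ.toGaloisRep.IsIrreducible) {ℓ : ℕ} (hℓ : ℓ.Prime) (hℓp : ℓ ≠ p) (hℓN : ℓ ∣ N)
    {w : HeightOneSpectrum (𝓞 ℚ)} (hw : (ℓ : 𝓞 ℚ) ∈ w.asIdeal) {m : ℕ} (hm : ((m : ℕ) : ℤ) = k - 1) :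
    ∃ (θ₀ : absoluteGaloisGroup ℚ →ₜ* (PadicAlgCl p)ˣ) (r : FramedGaloisRep ℚ (PadicAlgCl p) 2)
      (rv : WeilDeligneRep (w.adicCompletion ℚ) (PadicAlgCl p) (Fin 2 → PadicAlgCl p))
      (rC : WeilDeligneRep (w.adicCompletion ℚ) ℂ (Fin 2 → ℂ)),
      (∀ σ, ((θ₀ σ : (PadicAlgCl p)ˣ) : PadicAlgCl p) =
        ι.symm (nebentypus g (modNCyclotomicCharacter ℚ N σ : ZMod N))) ∧
      (∀ σ, ((ρ σ : GL (Fin 2) (PadicAlgCl p)) : Matrix (Fin 2) (Fin 2) (PadicAlgCl p)) =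
        ((θ₀ σ : (PadicAlgCl p)ˣ) : PadicAlgCl p) •
          ((r σ : GL (Fin 2) (PadicAlgCl p)) : Matrix (Fin 2) (Fin 2) (PadicAlgCl p))) ∧
      IsWeilDeligneOfLadic (r.toLocal w).toWeilGroupHom rv ∧
      rv.IsTransportAlong (ι : PadicAlgCl p →+* ℂ) rC ∧
      (1 - C ((qExpansion 1 ⇑g).coeff ℓ / (ℓ : ℂ) ^ m) * X) ∣
        rC.eulerFactor (absInertia_normal_holds _) (exists_isFrobPow_holds _) := by
  classical
  haveI : NeZero (N : ℚ) := NeZero.charZero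
  have hp : (p : ℕ).Prime := Fact.out
  have hcpt : isCompact_glFiniteIntegralLevel 2 ℚ := isCompact_glFiniteIntegralLevel_holds 2 ℚ
  have hwℓ : natGenerator w = ℓ :=
    (Nat.prime_dvd_prime_iff_eq (prime_natGenerator w) hℓ).mp ((Rat.natCast_mem_asIdeal_iff w).mp hw)
  have hwN : w.asIdeal ∣ Ideal.span {(N : 𝓞 ℚ)} := (Rat.natGenerator_dvd_iff w N).1 (hwℓ ▸ hℓN)
  have hpw : ((p : ℕ) : 𝓞 ℚ) ∉ w.asIdeal := by
    rw [Rat.natCast_mem_asIdeal_iff, hwℓ]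
    exact fun h => hℓp ((Nat.prime_dvd_prime_iff_eq hℓ hp).mp h)
  -- D-a: the datum and its new vector at `w`
  obtain ⟨π, hT, hSat, q₀, hq₀, hK, hU⟩ := exists_detTwist_datum g hk hg hcpt
  have hUw := hU w hwN
  have hLR := isLAlgebraic_of_hasInfinityType_weight (π := π) (by omega) hT
  -- D-b: the Galois twist `r = ρ ⊗ θ`, `θ = (ι⁻¹ ∘ χ ∘ χ_N)⁻¹`
  obtain ⟨θ₀, hθ₀⟩ := exists_continuousMonoidHom_dirichlet ι (nebentypus g)
  obtain ⟨θ, hθ⟩ : ∃ θ : absoluteGaloisGroup ℚ →ₜ* (PadicAlgCl p)ˣ, ∀ σ, θ σ = (θ₀ σ)⁻¹ :=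
    ⟨θ₀⁻¹, fun σ => rfl⟩
  obtain ⟨r, hr_def⟩ : ∃ r : FramedGaloisRep ℚ (PadicAlgCl p) 2, r = FramedRep.twist ρ θ := ⟨_, rfl⟩
  have hr : ∀ σ, r σ = Matrix.GeneralLinearGroup.scalar (Fin 2) (θ σ) * ρ σ := fun σ => by
    rw [hr_def, FramedRep.twist_apply, framedRep_scalar_eq]
  have hρr : ∀ σ, ((ρ σ : GL (Fin 2) (PadicAlgCl p)) : Matrix (Fin 2) (Fin 2) (PadicAlgCl p)) =
      ((θ₀ σ : (PadicAlgCl p)ˣ) : PadicAlgCl p) •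
        ((r σ : GL (Fin 2) (PadicAlgCl p)) : Matrix (Fin 2) (Fin 2) (PadicAlgCl p)) := fun σ => by
    rw [hr_def, FramedRep.coe_twist_apply, hθ, smul_smul, Units.val_inv_eq_inv_val,
      mul_inv_cancel₀ (θ₀ σ).ne_zero, one_smul]
  have hirr' : r.toGaloisRep.IsIrreducible := FramedRep.isIrreducible_of_twist hr hirr
  -- Satake–Frobenius compatibility of `(π, r)` away from `Np` (verbatim from `inertia_of_level_of_localGlobal'`)
  have hAE : SatakeFrobCompatibleAE ι π.1 r := by
    have hS : {v : HeightOneSpectrum (𝓞 ℚ) | ((primesEquiv v : Nat.Primes) : ℕ) ∣ N * p}.Finite := by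
      have hfin : {n : ℕ | n ∣ N * p}.Finite :=
        (N * p).divisors.finite_toSet.subset fun n hn ↦
          Nat.mem_divisors.mpr ⟨hn, mul_ne_zero (NeZero.ne N) hp.ne_zero⟩
      exact (hfin.preimage (f := fun v : HeightOneSpectrum (𝓞 ℚ) ↦ ((primesEquiv v : Nat.Primes) : ℕ))
        fun v _ v' _ h ↦ primesEquiv.injective (Subtype.ext h)).subset fun v hv => hv
    refine Filter.eventually_cofinite.mpr (hS.subset fun v hv => ?_)
    by_contra hvS
    apply hv
    have hq : ((primesEquiv v : Nat.Primes) : ℕ).Prime := (primesEquiv v).2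
    have hqNp : ¬ ((primesEquiv v : Nat.Primes) : ℕ) ∣ N * p := hvS
    have hqN : ¬ ((primesEquiv v : Nat.Primes) : ℕ) ∣ N := fun h ↦ hqNp (h.mul_right p)
    obtain ⟨q, hqdef⟩ : ∃ q : ℕ, ((primesEquiv v : Nat.Primes) : ℕ) = q := ⟨_, rfl⟩
    have hqv : (q : 𝓞 ℚ) ∈ v.asIdeal := by
      rw [Rat.natCast_mem_asIdeal_iff, ← hqdef]
      exact dvd_rfl
    have hqgen : natGenerator v = q :=
      (Nat.prime_dvd_prime_iff_eq (prime_natGenerator v) (hqdef ▸ hq)).mp ((Rat.natCast_mem_asIdeal_iff v).mp hqv)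
    obtain ⟨α, hα, hpoly⟩ := hSat q (hqdef ▸ hq) (hqdef ▸ hqN) v hqv
    obtain ⟨hunr, hfrob⟩ := hρ v hqNp
    have hqres : v.residueCard = q := by rw [GaloisRepresentations.Rat.residueCard_eq_natGenerator, hqgen]
    have hNv : ∀ 𝔓 ∈ v.primesAbove, ((N : ℕ) : absIntegers (𝓞 ℚ) ℚ) ∉ 𝔓 := fun 𝔓 h𝔓 =>
      Rat.natCast_not_mem_of_mem_primesAbove_of_not_dvd h𝔓 hqN
    have hθI : ∀ 𝔓 ∈ v.primesAbove, ∀ σ ∈ 𝔓.inertia (absoluteGaloisGroup ℚ), θ σ = 1 := by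
      intro 𝔓 h𝔓 σ hσ
      haveI : 𝔓.IsPrime := h𝔓.1
      rw [hθ, inv_eq_one]
      refine Units.ext ?_
      rw [hθ₀, modNCyclotomicCharacter_eq_one_of_mem_inertia (hNv 𝔓 h𝔓) hσ, Units.val_one, Units.val_one,
        MulChar.map_one, map_one]
    obtain ⟨cq, hcq⟩ : ∃ cq : PadicAlgCl p, cq = (ι.symm (nebentypus g (q : ZMod N)))⁻¹ := ⟨_, rfl⟩
    have hθF : ∀ 𝔓 ∈ v.primesAbove, ∀ σ : absoluteGaloisGroup ℚ, IsArithFrobAt (𝓞 ℚ) σ 𝔓 →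
        ((θ σ : (PadicAlgCl p)ˣ) : PadicAlgCl p) = cq := by
      intro 𝔓 h𝔓 σ hσ
      rw [hθ, Units.val_inv_eq_inv_val, hθ₀, modNCyclotomicCharacter_eq_residueCard_of_isArithFrobAt h𝔓 (hNv 𝔓 h𝔓) hσ,
        hqres, hcq]
    refine ⟨α, hα, hr_def ▸ FramedGaloisRep.isUnramifiedAt_twist hunr hθI, ?_⟩
    intro 𝔓 h𝔓 σ hσ
    obtain ⟨M, hMdef⟩ : ∃ M : Matrix (Fin 2) (Fin 2) (PadicAlgCl p),
        M = ((ρ σ : GL (Fin 2) (PadicAlgCl p)) : Matrix (Fin 2) (Fin 2) (PadicAlgCl p)) := ⟨_, rfl⟩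
    have hM : M.charpoly = (heckePolynomial g q).map
        ((ι.symm : ℂ →+* PadicAlgCl p).comp (algebraMap (coeffCharField g) ℂ)) := by
      rw [hMdef, ← hqdef]
      exact hfrob 𝔓 h𝔓 σ hσ
    have hM' : M.charpoly = X ^ 2 - C (ι.symm ((qExpansion 1 ⇑g).coeff q)) * X +
        C (ι.symm ((nebentypus g (q : ZMod N) : ℂ) * (q : ℂ) ^ (k - 1))) := by
      rw [hM, ← Polynomial.map_map, map_heckePolynomial]
      simp only [Polynomial.map_add, Polynomial.map_sub, Polynomial.map_mul, Polynomial.map_pow, Polynomial.map_X,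
        Polynomial.map_C, RingHom.coe_coe]
    have htrM : M.trace = ι.symm ((qExpansion 1 ⇑g).coeff q) := by
      have h := congrArg (fun P : (PadicAlgCl p)[X] => P.coeff 1) hM'
      simp only [Matrix.charpoly_fin_two, coeff_add, coeff_sub, coeff_X_pow, coeff_C_mul, coeff_X_one, coeff_C,
        if_neg (show (1 : ℕ) ≠ 2 by norm_num), if_neg (show (1 : ℕ) ≠ 0 by norm_num)] at h
      simpa using h
    have hdetM : M.det = ι.symm ((nebentypus g (q : ZMod N) : ℂ) * (q : ℂ) ^ (k - 1)) := by
      have h := congrArg (fun P : (PadicAlgCl p)[X] => P.coeff 0) hM'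
      simp only [Matrix.charpoly_fin_two, coeff_add, coeff_sub, coeff_X_pow, coeff_C_mul, coeff_X_zero, coeff_C_zero,
        if_neg (show (0 : ℕ) ≠ 2 by norm_num), mul_zero, sub_zero, zero_add] at h
      exact h
    have hχq : nebentypus g (q : ZMod N) ≠ 0 :=
      ((ZMod.isUnit_prime_of_not_dvd (hqdef ▸ hq) (hqdef ▸ hqN)).map (nebentypus g)).ne_zero
    have hιχ : ι.symm (nebentypus g (q : ZMod N)) ≠ 0 := by
      rwa [Ne, map_eq_zero_iff _ ι.symm.injective]
    have hA : cq * ι.symm ((qExpansion 1 ⇑g).coeff q) =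
        ι.symm ((qExpansion 1 ⇑g).coeff q * (nebentypus g (q : ZMod N) : ℂ)⁻¹) := by
      rw [map_mul, map_inv₀, hcq]
      ring
    have hB : cq ^ 2 * ι.symm ((nebentypus g (q : ZMod N) : ℂ) * (q : ℂ) ^ (k - 1)) =
        ι.symm ((nebentypus g (q : ZMod N) : ℂ)⁻¹ * (q : ℂ) ^ (k - 1)) := by
      rw [map_mul, map_mul, map_inv₀, hcq]
      field_simp
    have hmapC : (α.map fun a => X - C (ι.symm a⁻¹)).prod =
        ((α.map fun a => X - C a⁻¹).prod).map (ι.symm : ℂ →+* PadicAlgCl p) := by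
      rw [Polynomial.map_multiset_prod, Multiset.map_map]
      refine congrArg _ (Multiset.map_congr rfl fun a _ => ?_)
      simp only [Function.comp_apply, Polynomial.map_sub, Polynomial.map_X, Polynomial.map_C, RingHom.coe_coe]
    change Matrix.charpoly ((r σ : GL (Fin 2) (PadicAlgCl p)) : Matrix (Fin 2) (Fin 2) (PadicAlgCl p)) = _
    rw [hr_def, FramedRep.coe_twist_apply, hθF 𝔓 h𝔓 σ hσ, ← hMdef, Matrix.charpoly_fin_two, Matrix.trace_smul,
      Matrix.det_smul, Fintype.card_fin, smul_eq_mul, htrM, hdetM, hA, hB, hqres, arithFrobPolyOfSatake_one, hmapC,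
      hpoly]
    simp only [Polynomial.map_add, Polynomial.map_sub, Polynomial.map_mul, Polynomial.map_pow, Polynomial.map_X,
      Polynomial.map_C, RingHom.coe_coe]
  -- the carrier at `(ℚ, π, p, ι, r)`
  obtain ⟨llc, hllc⟩ := hLG ℚ inferInstance
  obtain ⟨-, hloc⟩ := hllc hcpt π hLR.1 hLR.2 p ι r hirr' hAE
  obtain ⟨πv, rv, rC, hπv, hlad, -, hTr, hcls⟩ := hloc w
  have hWD : IsWeilDeligneOfLadic (r.toLocal w).toWeilGroupHom rv := hlad hpw
  refine ⟨θ₀, r, rv, rC, hθ₀, hρr, hWD, hTr, ?_⟩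
  -- the local `L`-factor of the pair `(π_w, 𝟙)`: Tate's character, an invariant measure, genericity
  letI : MeasurableSpace
      (GL (Fin 1) (w.adicCompletion ℚ) ⧸ upperUnitriangular (Fin 1) (w.adicCompletion ℚ)) := borel _
  haveI : BorelSpace
      (GL (Fin 1) (w.adicCompletion ℚ) ⧸ upperUnitriangular (Fin 1) (w.adicCompletion ℚ)) := ⟨rfl⟩
  letI : MeasurableSpace (w.adicCompletion ℚ) := borel _
  haveI : BorelSpace (w.adicCompletion ℚ) := ⟨rfl⟩
  obtain ⟨μ', _, ν, hinv, hfin, hpos, -⟩ := exists_haar_measure_quotient_fin_one (F := w.adicCompletion ℚ)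
  haveI := hinv
  haveI := hfin
  haveI := hpos
  set ψ : AddChar (w.adicCompletion ℚ) Circle := (adeleAddChar ℚ).adicComponent w with hψ_def
  have hψ : ψ.IsContinuousNontrivial :=
    (isGlobalAddChar_adeleAddChar ℚ).isContinuousNontrivial_adicComponent (adicComponent_adeleAddChar_ne_one w)
  have hgen : IsGeneric πv.ρ ψ := π.isGeneric_of_hasLocalComponentAt w πv.ρ πv.isSmooth hπv
  -- the trivial irreducible smooth representation `𝟙` of `GL₁(ℚ_w)` on `ℂ`, generic for `ψ⁻¹`
  let π' : SmoothIrrep (GL (Fin 1) (w.adicCompletion ℚ)) :=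
    { V := ℂ
      ρ := Representation.trivial ℂ (GL (Fin 1) (w.adicCompletion ℚ)) ℂ
      isIrreducible := isIrreducible_of_finrank_eq_one' _ (Module.finrank_self ℂ)
      isSmooth := fun v => by
        have h : ((Representation.trivial ℂ (GL (Fin 1) (w.adicCompletion ℚ)) ℂ).stabilizerSubgroup v :
            Set (GL (Fin 1) (w.adicCompletion ℚ))) = Set.univ := by
          ext x
          simp
        rw [Representation.IsSmoothVector, h]
        exact isOpen_univ }
  have hgen' : IsGeneric π'.ρ ψ⁻¹ := by
    refine (isGeneric_iff _ _).2 ⟨LinearMap.id, (mem_whittakerFunctionals_iff _).2 fun u v => ?_,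
      fun h => one_ne_zero (LinearMap.congr_fun h (1 : ℂ))⟩
    have hs : superdiagSum u = 0 := by
      rw [superdiagSum_def]
      refine Finset.sum_eq_zero fun i _ => ?_
      have hi := i.isLt
      simp
    rw [whittakerCharFun_apply, hs, AddChar.map_zero_eq_one, Circle.coe_one, one_mul]
    rfl
  -- (iii-L): the Euler factor of `rec(π_w) ⊗ rec(𝟙)` is an `L`-polynomial of the pair, divisible by the pole
  set P₀ : ℂ[X] := ((((llc w).recGL 2 (IrrClass.mk πv)).out.1).tprod
      (((llc w).recGL 1 (IrrClass.mk π')).out.1)).eulerFactor (llc w).hn (llc w).hex with hP₀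
  have hRS₀ : HasRSLFactor Nat.one_lt_two πv.ρ π'.ρ ψ ν P₀ :=
    ((llc w).isLocalLanglands.lFactor_pairs Nat.one_pos Nat.one_lt_two πv π' ψ hψ hgen hgen' ν P₀).mpr hP₀
  have hdvd := one_sub_C_mul_X_dvd_of_hasRSLFactor_of_localComponent π q₀ hq₀ hK hUw πv hπv ν hRS₀
  rw [hwℓ, detTwist_eigenvalue_div_mul_sqrt hℓ.ne_zero hm, IsNewform1.heckeEigenvalue_eq_coeff_holds hg hℓ] at hdvd
  -- … and it is the Euler factor of `ι(r_w)` (F-semisimplification does not change it)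
  obtain ⟨r', hr', hq⟩ := hcls
  have hP₀' : P₀ = rC.eulerFactor (llc w).hn (llc w).hex :=
    (eulerFactor_tprod_out_eq_of_hasClass (llc w) πv π' (fun _ _ => rfl) r' hr'.isFrobSemisimple hq).trans
      (eulerFactor_eq_of_isFrobSemisimplificationOf hr' _ _)
  rw [hP₀'] at hdvd
  exact hdvd

/-- **The eigenvector of the twist when `a_ℓ(g) ≠ 0`.**  In the situation of
`exists_twist_weilDeligne_dvd` assume `a_ℓ(g) ≠ 0` and Carayol's theorem in inertia-invariants form
(`Carayol1986_finrank_inertiaInvariants`).  Then there is a non-zero `x ∈ ℚ̄_p²` fixed by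
`r(I_{ℚ_w})` on which a geometric Frobenius `Φ` of `W_{ℚ_w}` acts through `r` by
`ι⁻¹(a_ℓ(g) ℓ^{1-k})`.  Indeed `dim (ker N)^I ≤ 1` for `ι(r_w)` — otherwise `r_w` is unramified
with `N = 0` (`IsTransportAlong.N_eq_zero_and_ρ_eq_one_of_eq_top`), so is `r` at the prime `𝔓₀ ∣ w` of
the completion (`IsWeilDeligneOfLadic.eq_one_of_mem_inertia_of_N_eq_zero`), and `ρ = θ₀ · r` would be
scalar on `I_{𝔓₀}`, with `dim V^{I_{𝔓₀}} ∈ {0, 2}`, contradicting Carayol's `dim = 1` — so the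
divisibility `(1 - αX) ∣ det(1 - TΦ | (ker N)^I)` produces an eigenline
(`exists_mem_inertiaInvariantsKerN_apply_eq_smul`), moved back along `ι`
(`IsTransportAlong.exists_of_eigenvector`) and to `r|_{W_{ℚ_w}}` (Tate 1979, (4.2.1):
`IsWeilDeligneOfLadic.mulVec_eq_self_of_mem_inertia`, `exists_deg_eq_neg_one_mulVec_eq`).
[cite: CarayolASENS1986, Thm. (A) (0.7) with (0.5), (0.8), pp. 410–411] [cite: TateCorvallis1979, (4.1.6), (4.2.1)] -/
theorem exists_twist_eigenvector (hLG : galoisRep_GL2_totallyReal_localGlobal)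
    (hCd : Carayol1986_finrank_inertiaInvariants)
    (g : CuspForm (Gamma1 N) k) (hk : 2 ≤ k) (hg : IsNewform1 g)
    (p : ℕ) [Fact p.Prime] (ι : PadicAlgCl p ≃+* ℂ) (ρ : FramedGaloisRep ℚ (PadicAlgCl p) 2)
    (hρ : IsGaloisRepOfNewform1 g
      ((ι.symm : ℂ →+* PadicAlgCl p).comp (algebraMap (coeffCharField g) ℂ)) {q | q ∣ N * p} ρ)
    (hirr : ρ.toGaloisRep.IsIrreducible) {ℓ : ℕ} (hℓ : ℓ.Prime) (hℓp : ℓ ≠ p) (hℓN : ℓ ∣ N)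
    {w : HeightOneSpectrum (𝓞 ℚ)} (hw : (ℓ : 𝓞 ℚ) ∈ w.asIdeal) {m : ℕ} (hm : ((m : ℕ) : ℤ) = k - 1)
    (ha : (qExpansion 1 ⇑g).coeff ℓ ≠ 0) :
    ∃ (θ₀ : absoluteGaloisGroup ℚ →ₜ* (PadicAlgCl p)ˣ) (r : FramedGaloisRep ℚ (PadicAlgCl p) 2),
      (∀ σ, ((θ₀ σ : (PadicAlgCl p)ˣ) : PadicAlgCl p) =
        ι.symm (nebentypus g (modNCyclotomicCharacter ℚ N σ : ZMod N))) ∧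
      (∀ σ, ((ρ σ : GL (Fin 2) (PadicAlgCl p)) : Matrix (Fin 2) (Fin 2) (PadicAlgCl p)) =
        ((θ₀ σ : (PadicAlgCl p)ˣ) : PadicAlgCl p) •
          ((r σ : GL (Fin 2) (PadicAlgCl p)) : Matrix (Fin 2) (Fin 2) (PadicAlgCl p))) ∧
      ∃ x : Fin 2 → PadicAlgCl p, x ≠ 0 ∧
        (∀ u ∈ WeilGroup.inertia (w.adicCompletion ℚ),
          (((r.toLocal w).toWeilGroupHom u : GL (Fin 2) (PadicAlgCl p)) :
            Matrix (Fin 2) (Fin 2) (PadicAlgCl p)) *ᵥ x = x) ∧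
        ∃ Φ : WeilGroup (w.adicCompletion ℚ), WeilGroup.deg Φ = -1 ∧
          (((r.toLocal w).toWeilGroupHom Φ : GL (Fin 2) (PadicAlgCl p)) :
            Matrix (Fin 2) (Fin 2) (PadicAlgCl p)) *ᵥ x =
            ι.symm ((qExpansion 1 ⇑g).coeff ℓ / (ℓ : ℂ) ^ m) • x := by
  obtain ⟨θ₀, r, rv, rC, hθ₀, hρr, hWD, hTr, hdvd⟩ :=
    exists_twist_weilDeligne_dvd hLG g hk hg p ι ρ hρ hirr hℓ hℓp hℓN hw hm
  have h1 := (hCd g hk hg p ι ρ hρ hirr ℓ hℓ hℓp hℓN w hw _ (adicCompletionPrime_mem_primesAbove ℚ w)).1 ha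
  -- `dim (ker N)^I ≤ 1` for `ι(r_w)`
  have hrank : Module.finrank ℂ rC.inertiaInvariantsKerN ≤ 1 := by
    by_contra hlt
    push Not at hlt
    have htop : rC.inertiaInvariantsKerN = ⊤ := by
      refine Submodule.eq_top_of_finrank_eq (le_antisymm (Submodule.finrank_le _) ?_)
      rw [Module.finrank_fin_fun]
      omega
    obtain ⟨hN0, hρ1⟩ := hTr.N_eq_zero_and_ρ_eq_one_of_eq_top (ι : PadicAlgCl p →+* ℂ).injective htop
    have hr1 : ∀ τ ∈ (adicCompletionPrime ℚ w).inertia (absoluteGaloisGroup ℚ), r τ = 1 := by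
      intro τ hτ
      obtain ⟨u, hu, rfl⟩ := exists_mem_inertia_absGaloisRestrict_toAbsGalois_eq ℚ w hτ
      have h := hWD.eq_one_of_mem_inertia_of_N_eq_zero hN0 hρ1 hu
      rw [FramedRep.toWeilGroupHom_apply, FramedGaloisRep.toLocal_apply] at h
      exact h
    by_cases hall : ∀ τ ∈ (adicCompletionPrime ℚ w).inertia (absoluteGaloisGroup ℚ),
        ((θ₀ τ : (PadicAlgCl p)ˣ) : PadicAlgCl p) = 1
    · have htop' : ρ.toGaloisRep.fixedSubmodule ((adicCompletionPrime ℚ w).inertia (absoluteGaloisGroup ℚ)) = ⊤ := by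
        rw [eq_top_iff]
        intro v _
        rw [ContinuousRep.mem_fixedSubmodule]
        intro τ hτ
        rw [FramedRep.toContinuousRep_apply_apply, hρr, hr1 τ hτ, hall τ hτ, one_smul, Units.val_one,
          Matrix.one_mulVec]
      rw [htop', finrank_top, Module.finrank_fin_fun] at h1
      exact absurd h1 (by norm_num)
    · push Not at hall
      obtain ⟨τ, hτ, hθτ⟩ := hall
      have hbot : ρ.toGaloisRep.fixedSubmodule ((adicCompletionPrime ℚ w).inertia (absoluteGaloisGroup ℚ)) = ⊥ := by
        rw [eq_bot_iff]
        intro v hv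
        rw [Submodule.mem_bot]
        have h := (ContinuousRep.mem_fixedSubmodule _ _ _).mp hv τ hτ
        rw [FramedRep.toContinuousRep_apply_apply, hρr, hr1 τ hτ, Units.val_one, Matrix.smul_mulVec,
          Matrix.one_mulVec] at h
        have h' : (((θ₀ τ : (PadicAlgCl p)ˣ) : PadicAlgCl p) - 1) • v = 0 := by rw [sub_smul, one_smul, h, sub_self]
        exact (smul_eq_zero.mp h').resolve_left (sub_ne_zero.mpr hθτ)
      rw [hbot, finrank_bot] at h1
      exact absurd h1 (by norm_num)
  -- the eigenline of `ι(r_w)`, back along `ι` and to `r|_{W_{ℚ_w}}`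
  obtain ⟨Φ, hΦ, hΦx⟩ := hWD.exists_deg_eq_neg_one_mulVec_eq
  have hα0 : (qExpansion 1 ⇑g).coeff ℓ / (ℓ : ℂ) ^ m ≠ 0 :=
    div_ne_zero ha (pow_ne_zero _ (Nat.cast_ne_zero.mpr hℓ.ne_zero))
  obtain ⟨y, hy0, hyS, hyΦ⟩ := exists_mem_inertiaInvariantsKerN_apply_eq_smul rC (absInertia_normal_holds _)
    (exists_isFrobPow_holds _) hΦ hα0 hdvd hrank
  obtain ⟨hyN, hyI⟩ := (rC.mem_inertiaInvariantsKerN_iff y).mp hyS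
  obtain ⟨x, hx0, hxN, hxI, hxΦ⟩ := hTr.exists_of_eigenvector ι hy0 hyN hyI hyΦ
  refine ⟨θ₀, r, hθ₀, hρr, x, hx0, fun u hu => hWD.mulVec_eq_self_of_mem_inertia hu hxN (hxI u hu), Φ, hΦ, ?_⟩
  rw [hΦx x, hxΦ]

end Package

/-! ### Part 5. The Euler factor at `ℓ ∣ N` with `a_ℓ(g) ≠ 0` -/

section Line

open scoped Valued Pointwise
open ValuativeRel

variable {N : ℕ} [NeZero N] {k : ℤ}

/-- `ε(ℓ) = 0` for the nebentypus `ε` mod `N` and a prime `ℓ ∣ N`. [folklore] -/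
theorem nebentypus_natCast_eq_zero_of_dvd (g : CuspForm (Gamma1 N) k) {ℓ : ℕ} (hℓ : ℓ.Prime) (hℓN : ℓ ∣ N) :
    nebentypus g (ℓ : ZMod N) = 0 := by
  refine MulChar.map_nonunit _ fun h => ?_
  rw [ZMod.isUnit_iff_coprime] at h
  exact (hℓ.coprime_iff_not_dvd.mp h) hℓN

set_option maxHeartbeats 400000 in
/-- **Carayol's Euler factor at `ℓ ∣ N` when `a_ℓ(g) ≠ 0`: `det(1 - Frob T | (ρ_g)_{I_𝔔}) = 1 - ι⁻¹(a_ℓ) T`.**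
For a newform `g ∈ S_k(Γ₁(N))`, `k ≥ 2`, `ρ : Γ_ℚ → GL₂(ℚ̄_p)` irreducible and attached to `g`
away from `Np`, a prime `ℓ ∣ N`, `ℓ ≠ p`, with `a_ℓ(g) ≠ 0`, a prime `𝔔 ∣ ℓ` of `\bar ℤ` and an
arithmetic Frobenius `σ ∈ D_𝔔`: the reversed characteristic polynomial of `σ` on the inertia
coinvariants of `ρ` at `𝔔` is `1 - ι⁻¹(a_ℓ(g)) X` (`= 1 - ι⁻¹(a_ℓ) X + ι⁻¹(ε(ℓ) ℓ^{k-1}) X²`,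
`ε(ℓ) = 0`).  Proof: by `exists_twist_eigenvector`, `ρ = θ₀ · r` with a line `ℚ̄_p x` fixed by
`r(I_{𝔓₀})` on which the arithmetic Frobenii at `𝔓₀` act through `r` by `ι⁻¹(a_ℓ ℓ^{1-k})⁻¹`
(`I_{𝔓₀} = res I_{ℚ_w}`, Frobenius at `𝔓₀` = `res` of a degree-one Weil element, and
`deg (W Φ) = 0`); conjugating by `g₀` with `𝔔 = g₀ • 𝔓₀` the same holds at `𝔔` for `ρ(g₀) x`.
As `det ρ = θ₀ χ_p^{k-1}` (`det_eq_of_isGaloisRepOfNewform1`) is `θ₀` on `I_𝔔` and `θ₀(σ) ℓ^{k-1}`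
at `σ`, inertia moves every vector along `x` (`sub_mem_span_of_apply_eq_smul_of_det_eq`) and acts
non-trivially (Carayol: `dim V^{I_𝔔} = 1`), so the coinvariants are the line `V / ℚ̄_p x` on which
`σ` acts by `det ρ(σ) / (θ₀(σ) ι⁻¹(a_ℓ ℓ^{1-k})⁻¹) = ι⁻¹(a_ℓ)` (`charpoly_toCoinvariants_of_line`).
This is Carayol 1986, Thm. (A), read on the `ℓ`-Euler factor of `ρ_{g,p}`; Rohrlich 1997, §3.8
Thm. 5 in weight `2`.
[cite: CarayolASENS1986, Thm. (A) (0.7) with (0.5), (0.8), pp. 410–411] [cite: Rohrlich1997, §3.8 Thm. 5 (PDF p. 152)] -/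
theorem reverse_charpoly_toInertiaCoinvariants_of_dvd_of_coeff_ne_zero
    (hLG : galoisRep_GL2_totallyReal_localGlobal) (hCd : Carayol1986_finrank_inertiaInvariants)
    (g : CuspForm (Gamma1 N) k) (hk : 2 ≤ k) (hg : IsNewform1 g)
    (p : ℕ) [Fact p.Prime] (ι : PadicAlgCl p ≃+* ℂ) (ρ : FramedGaloisRep ℚ (PadicAlgCl p) 2)
    (hρ : IsGaloisRepOfNewform1 g
      ((ι.symm : ℂ →+* PadicAlgCl p).comp (algebraMap (coeffCharField g) ℂ)) {q | q ∣ N * p} ρ)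
    (hirr : ρ.toGaloisRep.IsIrreducible) {ℓ : ℕ} (hℓ : ℓ.Prime) (hℓp : ℓ ≠ p) (hℓN : ℓ ∣ N)
    {w : HeightOneSpectrum (𝓞 ℚ)} (hw : (ℓ : 𝓞 ℚ) ∈ w.asIdeal)
    {𝔔 : Ideal (absIntegers (𝓞 ℚ) ℚ)} (h𝔔 : 𝔔 ∈ w.primesAbove)
    (σ : 𝔔.decompositionSubgroup (absoluteGaloisGroup ℚ))
    (hσ : IsArithFrobAt (𝓞 ℚ) (σ : absoluteGaloisGroup ℚ) 𝔔) (ha : (qExpansion 1 ⇑g).coeff ℓ ≠ 0) :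
    (ρ.toGaloisRep.toInertiaCoinvariants 𝔔 σ).charpoly.reverse =
      1 - C (ι.symm (cuspCoeff g ℓ)) * X +
        C (ι.symm ((nebentypus g (ℓ : ZMod N) : ℂ) * (ℓ : ℂ) ^ (k - 1))) * X ^ 2 := by
  classical
  haveI : NeZero (N : ℚ) := NeZero.charZero
  have hp : (p : ℕ).Prime := Fact.out
  obtain ⟨m, hm⟩ : ∃ m : ℕ, ((m : ℕ) : ℤ) = k - 1 := ⟨(k - 1).toNat, Int.toNat_of_nonneg (by omega)⟩
  have hwℓ : natGenerator w = ℓ :=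
    (Nat.prime_dvd_prime_iff_eq (prime_natGenerator w) hℓ).mp ((Rat.natCast_mem_asIdeal_iff w).mp hw)
  have hpw : ((p : ℕ) : 𝓞 ℚ) ∉ w.asIdeal := by
    rw [Rat.natCast_mem_asIdeal_iff, hwℓ]
    exact fun h => hℓp ((Nat.prime_dvd_prime_iff_eq hℓ hp).mp h)
  obtain ⟨θ₀, r, hθ₀, hρr, x, hx0, hxI, Φ, hΦ, hxΦ⟩ :=
    exists_twist_eigenvector hLG hCd g hk hg p ι ρ hρ hirr hℓ hℓp hℓN hw hm ha
  obtain ⟨α, hα_def⟩ : ∃ α : ℂ, α = (qExpansion 1 ⇑g).coeff ℓ / (ℓ : ℂ) ^ m := ⟨_, rfl⟩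
  rw [← hα_def] at hxΦ
  have hℓ0 : (ℓ : ℂ) ^ m ≠ 0 := pow_ne_zero _ (Nat.cast_ne_zero.mpr hℓ.ne_zero)
  have hα0 : α ≠ 0 := by rw [hα_def]; exact div_ne_zero ha hℓ0
  have hια : ι.symm α ≠ 0 := by
    rw [Ne, map_eq_zero_iff _ ι.symm.injective]
    exact hα0
  -- at `𝔓₀`: inertia fixes `x` through `r`, arithmetic Frobenii act by `(ι⁻¹ α)⁻¹`
  have hI₀ : ∀ τ ∈ (adicCompletionPrime ℚ w).inertia (absoluteGaloisGroup ℚ),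
      ((r τ : GL (Fin 2) (PadicAlgCl p)) : Matrix (Fin 2) (Fin 2) (PadicAlgCl p)) *ᵥ x = x := by
    intro τ hτ
    obtain ⟨u, hu, rfl⟩ := exists_mem_inertia_absGaloisRestrict_toAbsGalois_eq ℚ w hτ
    have h := hxI u hu
    rw [FramedRep.toWeilGroupHom_apply, FramedGaloisRep.toLocal_apply] at h
    exact h
  have hF₀ : ∀ σ₀ : absoluteGaloisGroup ℚ, IsArithFrobAt (𝓞 ℚ) σ₀ (adicCompletionPrime ℚ w) →
      ((r σ₀ : GL (Fin 2) (PadicAlgCl p)) : Matrix (Fin 2) (Fin 2) (PadicAlgCl p)) *ᵥ x = (ι.symm α)⁻¹ • x := by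
    intro σ₀ hσ₀
    obtain ⟨W, hW1, rfl⟩ := exists_deg_eq_one_absGaloisRestrict_toAbsGalois_eq ℚ w hσ₀
    have hu : W * Φ ∈ WeilGroup.inertia (w.adicCompletion ℚ) := by
      rw [← WeilGroup.deg_eq_zero_iff_mem_inertia IsFrobPow.mul_holds IsFrobPow.unique_holds,
        WeilGroup.deg_mul IsFrobPow.mul_holds IsFrobPow.unique_holds, hW1, hΦ]
      norm_num
    have h := hxI (W * Φ) hu
    rw [map_mul, Matrix.GeneralLinearGroup.coe_mul, ← Matrix.mulVec_mulVec, hxΦ, Matrix.mulVec_smul,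
      FramedRep.toWeilGroupHom_apply, FramedGaloisRep.toLocal_apply] at h
    calc ((r (absGaloisRestrict ℚ (w.adicCompletion ℚ) (WeilGroup.toAbsGalois _ W)) : GL (Fin 2) (PadicAlgCl p)) :
            Matrix (Fin 2) (Fin 2) (PadicAlgCl p)) *ᵥ x
        = (ι.symm α)⁻¹ • (ι.symm α • (((r (absGaloisRestrict ℚ (w.adicCompletion ℚ) (WeilGroup.toAbsGalois _ W)) :
            GL (Fin 2) (PadicAlgCl p)) : Matrix (Fin 2) (Fin 2) (PadicAlgCl p)) *ᵥ x)) := by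
          rw [smul_smul, inv_mul_cancel₀ hια, one_smul]
      _ = (ι.symm α)⁻¹ • x := by rw [h]
  -- in terms of `ρ = θ₀ · r`
  have hρI₀ : ∀ τ ∈ (adicCompletionPrime ℚ w).inertia (absoluteGaloisGroup ℚ),
      ((ρ τ : GL (Fin 2) (PadicAlgCl p)) : Matrix (Fin 2) (Fin 2) (PadicAlgCl p)) *ᵥ x = ((θ₀ τ : (PadicAlgCl p)ˣ) : PadicAlgCl p) • x := fun τ hτ => by
    rw [hρr, Matrix.smul_mulVec, hI₀ τ hτ]
  have hρF₀ : ∀ σ₀ : absoluteGaloisGroup ℚ, IsArithFrobAt (𝓞 ℚ) σ₀ (adicCompletionPrime ℚ w) →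
      ((ρ σ₀ : GL (Fin 2) (PadicAlgCl p)) : Matrix (Fin 2) (Fin 2) (PadicAlgCl p)) *ᵥ x = (((θ₀ σ₀ : (PadicAlgCl p)ˣ) : PadicAlgCl p) * (ι.symm α)⁻¹) • x :=
    fun σ₀ hσ₀ => by rw [hρr, Matrix.smul_mulVec, hF₀ σ₀ hσ₀, smul_smul]
  -- transport to `𝔔`: `τ • 𝔔 = 𝔓₀` with `τ σ τ⁻¹` an arithmetic Frobenius at `𝔓₀`; the vector `x' = ρ(τ)⁻¹ x`
  obtain ⟨τ, hτ𝔔, hστ⟩ := HeightOneSpectrum.exists_isArithFrobAt_conj_of_mem_primesAbove_holds h𝔔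
    (adicCompletionPrime_mem_primesAbove ℚ w) hσ
  obtain ⟨x', hx'⟩ : ∃ x' : Fin 2 → PadicAlgCl p,
      x' = ((ρ τ⁻¹ : GL (Fin 2) (PadicAlgCl p)) : Matrix (Fin 2) (Fin 2) (PadicAlgCl p)) *ᵥ x := ⟨_, rfl⟩
  have hx'0 : x' ≠ 0 := by
    intro h0
    apply hx0
    have h := congrArg (fun v => ((ρ τ : GL (Fin 2) (PadicAlgCl p)) : Matrix (Fin 2) (Fin 2) (PadicAlgCl p)) *ᵥ v) h0
    simp only [hx', Matrix.mulVec_mulVec, Matrix.mulVec_zero] at h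
    rw [← Matrix.GeneralLinearGroup.coe_mul, ← map_mul, mul_inv_cancel, map_one, Units.val_one,
      Matrix.one_mulVec] at h
    exact h
  have hconj : ∀ (γ : absoluteGaloisGroup ℚ) (c : PadicAlgCl p),
      ((ρ (τ * γ * τ⁻¹) : GL (Fin 2) (PadicAlgCl p)) : Matrix (Fin 2) (Fin 2) (PadicAlgCl p)) *ᵥ x = c • x →
      ((ρ γ : GL (Fin 2) (PadicAlgCl p)) : Matrix (Fin 2) (Fin 2) (PadicAlgCl p)) *ᵥ x' = c • x' := by
    intro γ c h
    have e : γ * τ⁻¹ = τ⁻¹ * (τ * γ * τ⁻¹) := by group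
    rw [hx', Matrix.mulVec_mulVec, ← Matrix.GeneralLinearGroup.coe_mul, ← map_mul, e, map_mul,
      Matrix.GeneralLinearGroup.coe_mul, ← Matrix.mulVec_mulVec, h, Matrix.mulVec_smul]
  have hθconj : ∀ γ : absoluteGaloisGroup ℚ, θ₀ (τ * γ * τ⁻¹) = θ₀ γ := fun γ => by
    rw [map_mul, map_mul, map_inv, mul_right_comm, mul_inv_cancel, one_mul]
  have hρI : ∀ u ∈ 𝔔.inertia (absoluteGaloisGroup ℚ),
      ((ρ u : GL (Fin 2) (PadicAlgCl p)) : Matrix (Fin 2) (Fin 2) (PadicAlgCl p)) *ᵥ x' =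
        ((θ₀ u : (PadicAlgCl p)ˣ) : PadicAlgCl p) • x' := by
    intro u hu
    have hu' : τ * u * τ⁻¹ ∈ (adicCompletionPrime ℚ w).inertia (absoluteGaloisGroup ℚ) := by
      have h := (Ideal.conj_mem_inertia_smul_iff 𝔔 τ u).mpr hu
      rw [hτ𝔔] at h
      exact h
    have h := hconj u _ (hρI₀ _ hu')
    rw [hθconj] at h
    exact h
  have hρF : ((ρ (σ : absoluteGaloisGroup ℚ) : GL (Fin 2) (PadicAlgCl p)) : Matrix (Fin 2) (Fin 2) (PadicAlgCl p)) *ᵥ x' =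
      (((θ₀ (σ : absoluteGaloisGroup ℚ) : (PadicAlgCl p)ˣ) : PadicAlgCl p) * (ι.symm α)⁻¹) • x' := by
    have h := hconj _ _ (hρF₀ _ hστ)
    rw [hθconj] at h
    exact h
  -- determinants: `det ρ(τ) = θ₀(τ)` on `I_𝔔`, `det ρ(σ) = θ₀(σ) ℓ^m`
  have hdetI : ∀ τ ∈ 𝔔.inertia (absoluteGaloisGroup ℚ),
      ((ρ τ : GL (Fin 2) (PadicAlgCl p)) : Matrix (Fin 2) (Fin 2) (PadicAlgCl p)).det = ((θ₀ τ : (PadicAlgCl p)ˣ) : PadicAlgCl p) := by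
    intro τ hτ
    rw [det_eq_of_isGaloisRepOfNewform1 (continuous_algebraMap ℚ_[p] (PadicAlgCl p)) hρ hm,
      cyclotomicCharacter_eq_one_of_mem_inertia hpw h𝔔 hτ, Units.val_one, PadicInt.coe_one, map_one, one_pow,
      mul_one, RingHom.comp_apply, RingHom.coe_coe, IntermediateField.algebraMap_apply, coe_nebentypusCoeff, hθ₀]
  have hdetF : ((ρ (σ : absoluteGaloisGroup ℚ) : GL (Fin 2) (PadicAlgCl p)) : Matrix (Fin 2) (Fin 2) (PadicAlgCl p)).det =
      ((θ₀ (σ : absoluteGaloisGroup ℚ) : (PadicAlgCl p)ˣ) : PadicAlgCl p) * (ℓ : PadicAlgCl p) ^ m := by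
    rw [det_eq_of_isGaloisRepOfNewform1 (continuous_algebraMap ℚ_[p] (PadicAlgCl p)) hρ hm,
      GaloisRep.cyclotomicCharacter_apply_of_isArithFrobAt hpw h𝔔 hσ,
      GaloisRepresentations.Rat.residueCard_eq_natGenerator, hwℓ, PadicInt.coe_natCast, map_natCast,
      RingHom.comp_apply, RingHom.coe_coe, IntermediateField.algebraMap_apply, coe_nebentypusCoeff, hθ₀]
  -- the coinvariant line (`charpoly_toInertiaCoinvariants_of_eigenvector`) with `a c = θ₀(σ) ℓ^m`
  have hθne : ∀ γ, ((θ₀ γ : (PadicAlgCl p)ˣ) : PadicAlgCl p) ≠ 0 := fun γ => (θ₀ γ).ne_zero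
  have h1 := (hCd g hk hg p ι ρ hρ hirr ℓ hℓ hℓp hℓN w hw _ h𝔔).1 ha
  have hdetF' : ((ρ (σ : absoluteGaloisGroup ℚ) : GL (Fin 2) (PadicAlgCl p)) : Matrix (Fin 2) (Fin 2) (PadicAlgCl p)).det =
      ((θ₀ (σ : absoluteGaloisGroup ℚ) : (PadicAlgCl p)ˣ) : PadicAlgCl p) * (ι.symm α)⁻¹ * ι.symm (cuspCoeff g ℓ) := by
    rw [hdetF, mul_assoc]
    congr 1
    rw [show cuspCoeff g ℓ = (qExpansion 1 ⇑g).coeff ℓ from rfl, ← map_inv₀, ← map_mul, hα_def, inv_div,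
      div_mul_cancel₀ _ ha, map_pow, map_natCast]
  have hchar := FramedRep.charpoly_toInertiaCoinvariants_of_eigenvector ρ 𝔔 σ hx'0
    (fun γ => ((θ₀ γ : (PadicAlgCl p)ˣ) : PadicAlgCl p)) hθne hρI hdetI
    (mul_ne_zero (hθne _) (inv_ne_zero hια)) hρF hdetF' h1
  rw [hchar, Polynomial.reverse_X_sub_C', nebentypus_natCast_eq_zero_of_dvd g hℓ hℓN, zero_mul, map_zero, C_0,
    zero_mul, add_zero]

end Line

/-! ### Part 6. The Euler factor at `ℓ ∣ N` with `a_ℓ(g) = 0`: no coinvariants -/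

section Zero

open scoped Valued Pointwise
open ValuativeRel

variable {N : ℕ} [NeZero N] {k : ℤ}

/-- **Carayol's Euler factor at `ℓ ∣ N` when `a_ℓ(g) = 0`: `(ρ_g)_{I_𝔔} = 0`, so `det(1 - Frob T | (ρ_g)_{I_𝔔}) = 1`.**
For a newform `g ∈ S_k(Γ₁(N))`, `k ≥ 2`, `ρ : Γ_ℚ → GL₂(ℚ̄_p)` irreducible and attached to `g` away
from `Np`, a prime `ℓ ∣ N`, `ℓ ≠ p`, with `a_ℓ(g) = 0`, and `𝔔 ∣ ℓ`: the inertia coinvariants of `ρ`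
at `𝔔` vanish.  Carayol's theorem gives `V^{I_𝔔} = 0` (`Carayol1986_finrank_inertiaInvariants`); the
passage to the COinvariants uses the structure of `ρ|_{I}` at the prime `𝔓₀` of the completion:
`ρ = θ₀ · r` and `r(u) = r_w.ρ(u) exp(t(u) N)` on `I_{ℚ_w}` (Grothendieck–Deligne recipe,
`IsWeilDeligneOfLadic`, from the local–global carrier).  If `N = 0`, `ρ(I_{𝔓₀}) ⊆ θ₀(I) · r_w.ρ(I)` is
finite (`WeilDeligneRep.finite_image_inertia`) and averaging kills `V_{I}`
(`ker_inertiaCoinvariants_eq_top_of_finite`); if `N ≠ 0`, every `ρ(u)` commutes with `N` (`N² = 0`,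
`ρ_WD(u) N = N ρ_WD(u)`), some `ρ(u₁) = θ₀(u₁) exp(t N)` with `t ≠ 0`, and
`ker_inertiaCoinvariants_eq_top_of_nilpotent` applies.  Finally `V_{I_𝔔} = 0` for `𝔔 = g₀ • 𝔓₀`
(`ker_inertiaCoinvariants_eq_top_smul`), and the right-hand side is `1` as `a_ℓ = 0 = ε(ℓ)`.
[cite: CarayolASENS1986, Thm. (A) (0.7) with (0.5), (0.8), pp. 410–411] [cite: TateCorvallis1979, (4.2.1)] -/
theorem reverse_charpoly_toInertiaCoinvariants_of_dvd_of_coeff_eq_zero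
    (hLG : galoisRep_GL2_totallyReal_localGlobal) (hCd : Carayol1986_finrank_inertiaInvariants)
    (g : CuspForm (Gamma1 N) k) (hk : 2 ≤ k) (hg : IsNewform1 g)
    (p : ℕ) [Fact p.Prime] (ι : PadicAlgCl p ≃+* ℂ) (ρ : FramedGaloisRep ℚ (PadicAlgCl p) 2)
    (hρ : IsGaloisRepOfNewform1 g
      ((ι.symm : ℂ →+* PadicAlgCl p).comp (algebraMap (coeffCharField g) ℂ)) {q | q ∣ N * p} ρ)
    (hirr : ρ.toGaloisRep.IsIrreducible) {ℓ : ℕ} (hℓ : ℓ.Prime) (hℓp : ℓ ≠ p) (hℓN : ℓ ∣ N)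
    {w : HeightOneSpectrum (𝓞 ℚ)} (hw : (ℓ : 𝓞 ℚ) ∈ w.asIdeal)
    {𝔔 : Ideal (absIntegers (𝓞 ℚ) ℚ)} (h𝔔 : 𝔔 ∈ w.primesAbove)
    (σ : 𝔔.decompositionSubgroup (absoluteGaloisGroup ℚ)) (ha : (qExpansion 1 ⇑g).coeff ℓ = 0) :
    (ρ.toGaloisRep.toInertiaCoinvariants 𝔔 σ).charpoly.reverse =
      1 - C (ι.symm (cuspCoeff g ℓ)) * X +
        C (ι.symm ((nebentypus g (ℓ : ZMod N) : ℂ) * (ℓ : ℂ) ^ (k - 1))) * X ^ 2 := by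
  classical
  haveI : NeZero (N : ℚ) := NeZero.charZero
  obtain ⟨m, hm⟩ : ∃ m : ℕ, ((m : ℕ) : ℤ) = k - 1 := ⟨(k - 1).toNat, Int.toNat_of_nonneg (by omega)⟩
  obtain ⟨θ₀, r, rv, rC, hθ₀, hρr, hWD, -, -⟩ :=
    exists_twist_weilDeligne_dvd hLG g hk hg p ι ρ hρ hirr hℓ hℓp hℓN hw hm
  have hfix : ρ.toGaloisRep.fixedSubmodule ((adicCompletionPrime ℚ w).inertia (absoluteGaloisGroup ℚ)) = ⊥ :=
    (hCd g hk hg p ι ρ hρ hirr ℓ hℓ hℓp hℓN w hw _ (adicCompletionPrime_mem_primesAbove ℚ w)).2 ha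
  -- `ρ` on `I_{𝔓₀}` through the Weil group: `ρ(res u) = θ₀(res u) • r_W(u)`
  have hρW : ∀ u : WeilGroup (w.adicCompletion ℚ),
      ((ρ (absGaloisRestrict ℚ (w.adicCompletion ℚ) (WeilGroup.toAbsGalois _ u)) : GL (Fin 2) (PadicAlgCl p)) :
        Matrix (Fin 2) (Fin 2) (PadicAlgCl p)) =
      ((θ₀ (absGaloisRestrict ℚ (w.adicCompletion ℚ) (WeilGroup.toAbsGalois _ u)) : (PadicAlgCl p)ˣ) : PadicAlgCl p) •
        (((r.toLocal w).toWeilGroupHom u : GL (Fin 2) (PadicAlgCl p)) : Matrix (Fin 2) (Fin 2) (PadicAlgCl p)) :=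
    fun u => by rw [hρr, FramedRep.toWeilGroupHom_apply, FramedGaloisRep.toLocal_apply]
  -- the coinvariants at `𝔓₀` vanish
  have hker₀ : Representation.Coinvariants.ker ((ρ.toGaloisRep.restrictDecomposition (adicCompletionPrime ℚ w)).comp
      ((adicCompletionPrime ℚ w).inertia ((adicCompletionPrime ℚ w).decompositionSubgroup (absoluteGaloisGroup ℚ))).subtype) = ⊤ := by
    by_cases hN : rv.N = 0
    · -- `N = 0`: `ρ(I_{𝔓₀})` is finite
      refine FramedRep.ker_inertiaCoinvariants_eq_top_of_finite ρ _ ?_ hfix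
      have hT : (Set.range fun a : (ZMod N)ˣ => ι.symm (nebentypus g (a : ZMod N))).Finite := Set.finite_range _
      have hM : ((fun f : Module.End (PadicAlgCl p) (Fin 2 → PadicAlgCl p) => LinearMap.toMatrix' f) ''
          ((fun x : (Module.End (PadicAlgCl p) (Fin 2 → PadicAlgCl p))ˣ => (x : Module.End (PadicAlgCl p) (Fin 2 → PadicAlgCl p))) ''
            (rv.ρ.toHomUnits '' (WeilGroup.inertia (w.adicCompletion ℚ) : Set (WeilGroup (w.adicCompletion ℚ)))))).Finite :=
        ((WeilDeligneRep.finite_image_inertia rv).image _).image _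
      refine ((hT.prod hM).image fun q : PadicAlgCl p × Matrix (Fin 2) (Fin 2) (PadicAlgCl p) => q.1 • q.2).subset ?_
      rintro _ ⟨u, hu, rfl⟩
      obtain ⟨u', hu', rfl⟩ := exists_mem_inertia_absGaloisRestrict_toAbsGalois_eq ℚ w hu
      refine ⟨(ι.symm (nebentypus g (modNCyclotomicCharacter ℚ N
          (absGaloisRestrict ℚ (w.adicCompletion ℚ) (WeilGroup.toAbsGalois _ u')) : ZMod N)),
        LinearMap.toMatrix' (rv.ρ u')), ⟨⟨_, rfl⟩, ?_⟩, ?_⟩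
      · exact ⟨rv.ρ u', ⟨rv.ρ.toHomUnits u', ⟨u', hu', rfl⟩, rfl⟩, rfl⟩
      · dsimp only
        rw [hρW u', hθ₀, hWD.coe_eq_toMatrix'_of_N_eq_zero hN hu']
    · -- `N ≠ 0`: nilpotent monodromy
      have hN0 : LinearMap.toMatrix' rv.N ≠ 0 := fun h0 =>
        hN (LinearMap.toMatrix'.injective (by rw [h0, map_zero]))
      have hN2lin : rv.N * rv.N = 0 := by
        have h1 := LinearMap.aeval_self_charpoly rv.N
        rw [rv.isNilpotent_N.charpoly_eq_X_pow_finrank, Module.finrank_fin_fun, map_pow, aeval_X, pow_two] at h1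
        exact h1
      have hN2 : LinearMap.toMatrix' rv.N * LinearMap.toMatrix' rv.N = 0 := by
        rw [← LinearMap.toMatrix'_mul, hN2lin, map_zero]
      have hexp : ∀ c : PadicAlgCl p, IsNilpotent.exp (c • LinearMap.toMatrix' rv.N) = 1 + c • LinearMap.toMatrix' rv.N := by
        intro c
        have h2 : (c • LinearMap.toMatrix' rv.N) ^ 2 = 0 := by
          rw [pow_two, Matrix.smul_mul, Matrix.mul_smul, hN2, smul_zero, smul_zero]
        rw [IsNilpotent.exp_eq_sum h2, Finset.sum_range_succ, Finset.sum_range_succ, Finset.sum_range_zero, zero_add,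
          pow_zero, pow_one, Nat.factorial_zero, Nat.factorial_one, Nat.cast_one, inv_one, one_smul, one_smul]
      have hcomm : ∀ u ∈ (adicCompletionPrime ℚ w).inertia (absoluteGaloisGroup ℚ),
          ((ρ u : GL (Fin 2) (PadicAlgCl p)) : Matrix (Fin 2) (Fin 2) (PadicAlgCl p)) * LinearMap.toMatrix' rv.N =
            LinearMap.toMatrix' rv.N * ((ρ u : GL (Fin 2) (PadicAlgCl p)) : Matrix (Fin 2) (Fin 2) (PadicAlgCl p)) := by
        intro u hu
        obtain ⟨u', hu', rfl⟩ := exists_mem_inertia_absGaloisRestrict_toAbsGalois_eq ℚ w hu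
        obtain ⟨c, hc⟩ := hWD.exists_coe_eq_mul_exp hu'
        have hMN : Commute (LinearMap.toMatrix' (rv.ρ u')) (LinearMap.toMatrix' rv.N) :=
          rv.toMatrix'_ρ_mul_toMatrix'_N hu'
        have hEN : Commute (1 + c • LinearMap.toMatrix' rv.N) (LinearMap.toMatrix' rv.N) :=
          (Commute.one_left _).add_left ((Commute.refl _).smul_left c)
        rw [hρW u', hc, hexp]
        exact (hMN.mul_left hEN).smul_left _
      obtain ⟨u₁, hu₁, c₁, hc₁, hρWu₁⟩ := hWD.exists_coe_eq_exp
      have hu₁' := absGaloisRestrict_toAbsGalois_mem_inertia ℚ w hu₁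
      have hρu₁ : ((ρ (absGaloisRestrict ℚ (w.adicCompletion ℚ) (WeilGroup.toAbsGalois _ u₁)) : GL (Fin 2) (PadicAlgCl p)) :
          Matrix (Fin 2) (Fin 2) (PadicAlgCl p)) =
          ((θ₀ (absGaloisRestrict ℚ (w.adicCompletion ℚ) (WeilGroup.toAbsGalois _ u₁)) : (PadicAlgCl p)ˣ) : PadicAlgCl p) •
            (1 + c₁ • LinearMap.toMatrix' rv.N) := by
        rw [hρW u₁, hρWu₁, hexp]
      exact FramedRep.ker_inertiaCoinvariants_eq_top_of_nilpotent ρ _ (LinearMap.toMatrix' rv.N) hN0 hN2 hcomm hu₁' hc₁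
        hρu₁ hfix
  -- transport to `𝔔 = g₀ • 𝔓₀`; both sides are `1`
  obtain ⟨g₀, hg₀⟩ := HeightOneSpectrum.exists_smul_eq_of_mem_primesAbove_holds
    (adicCompletionPrime_mem_primesAbove ℚ w) h𝔔
  have hker := FramedRep.ker_inertiaCoinvariants_eq_top_smul ρ _ g₀ hker₀
  rw [hg₀] at hker
  rw [FramedRep.charpoly_toInertiaCoinvariants_eq_one ρ 𝔔 σ hker, Polynomial.reverse_one',
    show cuspCoeff g ℓ = (qExpansion 1 ⇑g).coeff ℓ from rfl, ha, nebentypus_natCast_eq_zero_of_dvd g hℓ hℓN, zero_mul,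
    map_zero, C_0, zero_mul, zero_mul, sub_zero, add_zero]

end Zero

/-! ### Part 7. The unramified primes, Carayol's theorem in Euler-factor form, and `L(E/F, s)` -/

section Assembly

variable {N : ℕ} [NeZero N] {k : ℤ}

/-- **The Euler factor at `ℓ ∤ Np`: `det(1 - Frob T | (ρ_g)_{I_𝔔}) = 1 - ι⁻¹(a_ℓ) T + ι⁻¹(ε(ℓ) ℓ^{k-1}) T²`.**
At a prime `ℓ ∤ Np` the representation is unramified, the inertia coinvariants are everything
(`ContinuousRep.charpoly_toInertiaCoinvariants`) and the characteristic polynomial of an arithmetic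
Frobenius is the Hecke polynomial `X² - a_ℓ X + ε(ℓ) ℓ^{k-1}` (`IsGaloisRepOfNewform1`), whose reverse is
the stated Euler factor.  Deligne 1971 / Diamond–Shurman Thm. 9.6.5.
[cite: DiamondShurman2005, Thm. 9.6.5] [cite: Rohrlich1997, §3.1 (PDF pp. 131–132)] -/
theorem reverse_charpoly_toInertiaCoinvariants_of_not_dvd
    (g : CuspForm (Gamma1 N) k) (p : ℕ) [Fact p.Prime] (ι : PadicAlgCl p ≃+* ℂ)
    (ρ : FramedGaloisRep ℚ (PadicAlgCl p) 2)
    (hρ : IsGaloisRepOfNewform1 g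
      ((ι.symm : ℂ →+* PadicAlgCl p).comp (algebraMap (coeffCharField g) ℂ)) {q | q ∣ N * p} ρ)
    {ℓ : ℕ} (hℓ : ℓ.Prime) (hℓp : ℓ ≠ p) (hℓN : ¬ ℓ ∣ N)
    {w : HeightOneSpectrum (𝓞 ℚ)} (hw : (ℓ : 𝓞 ℚ) ∈ w.asIdeal)
    {𝔔 : Ideal (absIntegers (𝓞 ℚ) ℚ)} (h𝔔 : 𝔔 ∈ w.primesAbove)
    (σ : 𝔔.decompositionSubgroup (absoluteGaloisGroup ℚ)) (hσ : IsArithFrobAt (𝓞 ℚ) (σ : absoluteGaloisGroup ℚ) 𝔔) :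
    (ρ.toGaloisRep.toInertiaCoinvariants 𝔔 σ).charpoly.reverse =
      1 - C (ι.symm (cuspCoeff g ℓ)) * X +
        C (ι.symm ((nebentypus g (ℓ : ZMod N) : ℂ) * (ℓ : ℂ) ^ (k - 1))) * X ^ 2 := by
  have hp : (p : ℕ).Prime := Fact.out
  have hwℓ : natGenerator w = ℓ :=
    (Nat.prime_dvd_prime_iff_eq (prime_natGenerator w) hℓ).mp ((Rat.natCast_mem_asIdeal_iff w).mp hw)
  have hwq : ((primesEquiv w : Nat.Primes) : ℕ) = ℓ := hwℓ
  have hℓNp : ((primesEquiv w : Nat.Primes) : ℕ) ∉ {q | q ∣ N * p} := by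
    rw [hwq]
    intro h
    rcases (Nat.Prime.dvd_mul hℓ).mp h with h | h
    · exact hℓN h
    · exact hℓp ((Nat.prime_dvd_prime_iff_eq hℓ hp).mp h)
  obtain ⟨hunr, hfrob⟩ := hρ w hℓNp
  have h1 : ∀ τ ∈ 𝔔.inertia (absoluteGaloisGroup ℚ), ρ.toGaloisRep τ = 1 := by
    intro τ hτ
    have h := hunr 𝔔 h𝔔 τ hτ
    refine LinearMap.ext fun v => ?_
    rw [FramedRep.toContinuousRep_apply_apply, h, Units.val_one, Matrix.one_mulVec, Module.End.one_apply]
  rw [ContinuousRep.charpoly_toInertiaCoinvariants ρ.toGaloisRep 𝔔 h1 σ,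
    (FramedGaloisRep.hasFrobCharpolyAt_toGaloisRep_iff w _ ρ).mpr hfrob 𝔔 h𝔔 σ hσ, hwq, ← Polynomial.map_map,
    map_heckePolynomial, show cuspCoeff g ℓ = (qExpansion 1 ⇑g).coeff ℓ from rfl]
  simp only [Polynomial.map_add, Polynomial.map_sub, Polynomial.map_mul, Polynomial.map_pow, Polynomial.map_X,
    Polynomial.map_C, RingHom.coe_coe]
  exact Polynomial.reverse_X_sq_sub_C_mul_X_add_C _ _

/-- **Carayol's theorem (A) in Euler-factor form, from the tree's named facts
`galoisRep_GL2_totallyReal_localGlobal` (local–global compatibility, Carayol 1986) and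
`Carayol1986_finrank_inertiaInvariants` (the dimension of the inertia invariants).**  For every
newform `g ∈ S_k(Γ₁(N))`, `k ≥ 2`, every `ι : ℚ̄_p ≃ ℂ`, every irreducible `ρ : Γ_ℚ → GL₂(ℚ̄_p)`
attached to `g` away from `Np`, every prime `ℓ ≠ p`, every prime `𝔔 ∣ ℓ` of `\bar ℤ` and every
arithmetic Frobenius `σ ∈ D_𝔔`:
`det(1 - σ T | (ρ)_{I_𝔔}) = 1 - ι⁻¹(a_ℓ(g)) T + ι⁻¹(ε(ℓ) ℓ^{k-1}) T²` — the `ℓ`-Euler factor of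
`L(g, s)` (Carayol 1986, Thm. (A), (0.7) with (0.5), (0.8); over `ℚ`, Langlands 1973 and Deligne;
Rohrlich 1997, §3.8 Thm. 5 in weight `2`).  This is, character for character, the hypothesis `hC` of
`hasEntireLFunction_baseChange_fixedField_of_modularity_of_carayol`.  Cases: `ℓ ∤ N`
(`reverse_charpoly_toInertiaCoinvariants_of_not_dvd`), `ℓ ∣ N` with `a_ℓ ≠ 0`
(`…_of_dvd_of_coeff_ne_zero`) and with `a_ℓ = 0` (`…_of_dvd_of_coeff_eq_zero`).
[cite: CarayolASENS1986, Thm. (A) (0.7) with (0.5), (0.8), pp. 410–411]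
[cite: Rohrlich1997, §3.8 Thm. 5 (PDF p. 152)] -/
theorem carayol_eulerFactor_of_localGlobal (hLG : galoisRep_GL2_totallyReal_localGlobal)
    (hCd : Carayol1986_finrank_inertiaInvariants) :
    ∀ {N : ℕ} [NeZero N] {k : ℤ} (g : CuspForm (Gamma1 N) k), 2 ≤ k → IsNewform1 g →
      ∀ (p : ℕ) [Fact p.Prime] (ι : PadicAlgCl p ≃+* ℂ) (ρ : FramedGaloisRep ℚ (PadicAlgCl p) 2),
        IsGaloisRepOfNewform1 g
          ((ι.symm : ℂ →+* PadicAlgCl p).comp (algebraMap (coeffCharField g) ℂ)) {q | q ∣ N * p} ρ →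
        ρ.toGaloisRep.IsIrreducible →
      ∀ ℓ : ℕ, ℓ.Prime → ℓ ≠ p →
      ∀ w : HeightOneSpectrum (𝓞 ℚ), (ℓ : 𝓞 ℚ) ∈ w.asIdeal → ∀ 𝔔 ∈ w.primesAbove,
      ∀ σ : 𝔔.decompositionSubgroup (absoluteGaloisGroup ℚ),
        IsArithFrobAt (𝓞 ℚ) (σ : absoluteGaloisGroup ℚ) 𝔔 →
        (ρ.toGaloisRep.toInertiaCoinvariants 𝔔 σ).charpoly.reverse =
          1 - C (ι.symm (cuspCoeff g ℓ)) * X +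
            C (ι.symm ((nebentypus g (ℓ : ZMod N) : ℂ) * (ℓ : ℂ) ^ (k - 1))) * X ^ 2 := by
  intro N _ k g hk hg p _ ι ρ hρ hirr ℓ hℓ hℓp w hw 𝔔 h𝔔 σ hσ
  by_cases hℓN : ℓ ∣ N
  · by_cases ha : (qExpansion 1 ⇑g).coeff ℓ = 0
    · exact reverse_charpoly_toInertiaCoinvariants_of_dvd_of_coeff_eq_zero hLG hCd g hk hg p ι ρ hρ hirr hℓ hℓp hℓN
        hw h𝔔 σ ha
    · exact reverse_charpoly_toInertiaCoinvariants_of_dvd_of_coeff_ne_zero hLG hCd g hk hg p ι ρ hρ hirr hℓ hℓp hℓN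
        hw h𝔔 σ hσ ha
  · exact reverse_charpoly_toInertiaCoinvariants_of_not_dvd g p ι ρ hρ hℓ hℓp hℓN hw h𝔔 σ hσ

/-- **`L(E/F, s)` is entire for every abelian number field `F = ℚ(ζ_m)^H`, modulo modularity,
Deligne's representations and Carayol's local–global compatibility** — the named fact
`hasEntireLFunction_baseChange_fixedField` (BCDT 2001, Thm. A with Artin formalism, Rohrlich 1997
§3.8–3.9) from FOUR EXISTING named facts of the tree and nothing else: the modularity theorem
`exists_isNewformOf`, Deligne's `ℓ`-adic representations `Hida2000_thm326_exists_galoisRep`, the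
local–global carrier `galoisRep_GL2_totallyReal_localGlobal` and Carayol's
`Carayol1986_finrank_inertiaInvariants`; the inline hypothesis `hC` of
`hasEntireLFunction_baseChange_fixedField_of_modularity_of_carayol` is discharged by
`carayol_eulerFactor_of_localGlobal`.
[cite: BCDTJAMS2001, Thm. A] [cite: Rohrlich1997, §3.8 Thm. 5, §3.9 (PDF pp. 152–156)]
[cite: CarayolASENS1986, Thm. (A) (0.7) with (0.5), (0.8), pp. 410–411] -/
theorem hasEntireLFunction_baseChange_fixedField_of_modularity_of_localGlobal
    (hX : exists_isNewformOf) (hD : Hida2000_thm326_exists_galoisRep)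
    (hLG : galoisRep_GL2_totallyReal_localGlobal) (hCd : Carayol1986_finrank_inertiaInvariants) :
    hasEntireLFunction_baseChange_fixedField :=
  hasEntireLFunction_baseChange_fixedField_of_modularity_of_carayol hX hD (carayol_eulerFactor_of_localGlobal hLG hCd)

end Assembly

end Literature.NumberTheory.EllipticCurves

end
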